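import Literature.Topology.FourManifolds.PlaneAtlasManifold
import Literature.Topology.FourManifolds.PlanarSeams
import Literature.Topology.FourManifolds.RegularLevelCollarBand
import Literature.Topology.FourManifolds.ProperMorseFunction
import Literature.Topology.FourManifolds.PlaneLevelCircles
import Literature.Topology.FourManifolds.CircleDiffeotopyProofs
import Literature.Geometry.Manifold.SmoothEmbeddingInverse
import Literature.Topology.PlaneTopology.Schoenflies
import Literature.Topology.PlaneTopology.ChartParity
import HarnessLib

/-!
# The exotic annulus: an essential level circle of a proper Morse function, its smooth collar,
# the cap, and the seam lemma of the smoothing induction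

Topic `Literature/Topology/FourManifolds` (smoothing theory of surfaces; the **essential seam**
of the `n = 2` leaf — Radó 1925 / Kerékjártó: every topological surface admits a smooth
structure — of the named fact
`Literature.Topology.FourManifolds.exists_chartedSpace_isManifold_of_le_three`, spc4.S33).
In the chart-by-chart construction of a smooth structure (E. E. Moise, *Geometric topology in
dimensions 2 and 3*, GTM 47, Ch. 8; A. Hatcher, arXiv:1312.3518, Thm. A) the seam circle may lie
entirely in the part `W` already smoothed; the given smooth plane atlas `𝒮` restricted to the
open annulus `A = {ρ - η < ‖z‖ < ρ + η} ⊆ W` is then a possibly *exotic* smooth structure on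
`A`, and the straightening of `PlanarSeams.lean` (which needs a free point of the seam) is not
available. The classical remedy (J. R. Munkres, *Obstructions to the smoothing of
piecewise-differentiable homeomorphisms*, Ann. of Math. 72 (1960), §§1–2; Hatcher, handle
smoothing (1)) is an **`𝒮`-smooth essential circle with an `𝒮`-smooth collar**, along which the
inner domain is capped by a standard disc. Here circle and collar come from Morse theory on the
exotic annulus `𝒮.Man` (`PlaneAtlasManifold.lean`), using the tree's proper Morse functions,
regular levels and flows:

**§1 Level.** `PlaneAtlas.annulus`, `exists_annulus_subset`; the core circle of `𝒮.Man`, which is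
connected and not compact; `exists_regular_level`, `LevelData` — a proper Morse function `f`
(`exists_isMorse_tendsto_cocompact_atTop_euclidean`) and a nonempty regular level `a` above
`max f(core)` (`exists_regularLevel_gt_of_isMorse`), whose bands are compact, hence a
`BandUnitField` (`RegularLevelCollarBand.lean`, Milnor 1963 Thm. 3.1) with product chart `Φ`; the
level components are smoothly embedded circles
(`PlaneLevelCircles.exists_isSmoothEmbedding_range_eq_of_opens`), hence planar Jordan curves
(`LevelData.curve`, via `exists_homeomorph_addCircle_forall_eq`) with inner Jordan domains
`LevelData.dom` (Jordan curve theorem); tubes (flow-outs of components), the component `P` of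
`{f < a}` containing the core, two-sidedness (`val_tubePos_subset_dom`), and
`LevelData.exists_essential` — **an essential level component exists** (one whose inner
domain contains `0`): otherwise `val(P) ∪ ⋃ closure(inner domains of the components adjacent
to P)` would be a nonempty clopen subset of `ℂ` inside the annulus.

**§2 Collar.** For a level component, the flow of the band unit field `U` and a smooth embedding
`γ : 𝕊¹ → 𝒮.Man` onto it give the collar map `c z = fl (γ (direction of z)) (σ δ log ‖z‖)`
(`LevelData.Collar.collarMap`; Milnor 1965, Thm. 3.4), an `𝒮`-smooth diffeomorphism of the round
annulus `{e^{-1/2} < ‖z‖ < e^{1/2}}` onto a tube (`collarInv`, `tubeC`, `bijOn_collarMap`,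
`contMDiffOn_collarInv` via `contMDiffOn_invFun_range`; read in the charts of `𝒮`:
`contDiffOn_chart_collarMap`, `contDiffOn_collarInv_chart_symm`); its planar image
`cP = val ∘ collarMap`, curves `J r = cP '' {‖z‖ = r}` (Jordan curves) with inner domains
`domR`, the half-collars `Bin`, `Bout` on opposite sides of the unit curve (`Bin_Bout_sides`),
reversal (`reverse`, `radInv`, `Bin_reverse`) and a well-oriented collar
(`exists_collar_Bin_subset`); nesting (`J_subset_dom`, `closure_domR_subset_dom`) and the region
identity `dom ∖ closure (domR r₀) = cP {r₀ < ‖z‖ < 1}` (`dom_diff_closure_domR_eq`, by the annulus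
theorem `exists_homeomorph_image_annulus`).

**§3 Cap and seam.** `PlaneAtlas.agreeOn_pullback_stdAtlas_of_contDiffOn` (a transported standard
structure agrees with an atlas when `e ∘ s⁻¹`, `s ∘ e⁻¹` are `C^∞`); the cap — a Schoenflies
filler of an inner collar curve (`CapFill`, from `JordanDomain.exists_homeomorph_eqOn_frontier`)
pasted with the planar collar on the shell `{r₀ ≤ ‖z‖ ≤ 1}` — is a bijection of the closed unit
disc onto the closed inner domain (`bijOn_cap`), whence the partial homeomorphism `capChart`;
`agreeOn_cap_band`; `PlaneAtlas.exists_planeAtlas_cap` — **capping the exotic annulus**: a plane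
atlas `𝒮₀` on `W ⊇ A` extends, after modification inside `{‖z‖ ≤ ρ + η}`, to a plane atlas on
`W' ⊇ W ∪ {‖z‖ < ρ}` (`AtlasOn.union` of the capped disc with `𝒮₀` restricted off the inner
collar curve); and `exists_planeAtlas_seam` — **the seam lemma** of the smoothing induction,
combining this essential case with the inessential one (`exists_planeAtlas_seam_of_not_subset`,
`PlanarSeams.lean`): a smooth plane atlas `𝒮` on `W`, `L ⊆ W` with `L ∩ {‖z‖ = 2}` closed,
extends — after modification inside `{‖z‖ ≤ 3}` — to a smooth plane atlas on an open set
containing `W ∖ {‖z‖ ≤ 3}`, `{‖z‖ < 2}` and `L`.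

Everything is proved; no named facts are introduced.

## References

* J. Milnor, *Morse theory*, Ann. of Math. Studies 51 (1963), §§2–3, Thm. 3.1.
* J. Milnor, *Lectures on the h-cobordism theorem*, Princeton (1965), Thm. 3.4 and its proof.
* J. R. Munkres, *Obstructions to the smoothing of piecewise-differentiable homeomorphisms*,
  Ann. of Math. 72 (1960), §§1–2.
* E. E. Moise, *Geometric topology in dimensions 2 and 3*, GTM 47 (1977), Ch. 8.
* A. Hatcher, *The Kirby torus trick for surfaces*, arXiv:1312.3518 (2013), Thm. A.
-/


noncomputable section

namespace Literature.Topology.FourManifolds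

open _root_.Set _root_.Metric _root_.OpenPartialHomeomorph _root_.Filter
open scoped _root_.Manifold _root_.Topology _root_.ContDiff
open Literature.Geometry.Manifold (AtlasOn)
open Literature.Geometry.Manifold.AtlasOn

/-- Local notation for the model plane `ℝ²`. -/
local notation "𝔼₂" => EuclideanSpace ℝ (Fin 2)

namespace PlaneAtlas

/-! ### The exotic annulus: a plane atlas around a circle, restricted to a thin open annulus -/

/-- The open annulus `{ρ - η < ‖z‖ < ρ + η}`. [folklore] -/
def annulus (ρ η : ℝ) : Set ℂ := {z | ρ - η < ‖z‖ ∧ ‖z‖ < ρ + η}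

/-- The open annulus is open. [folklore] -/
theorem isOpen_annulus (ρ η : ℝ) : IsOpen (annulus ρ η) :=
  (isOpen_lt continuous_const continuous_norm).inter (isOpen_lt continuous_norm continuous_const)

/-- Membership in the annulus (definitional). [folklore] -/
theorem mem_annulus {ρ η : ℝ} {z : ℂ} : z ∈ annulus ρ η ↔ ρ - η < ‖z‖ ∧ ‖z‖ < ρ + η := Iff.rfl

/-- The annulus is bounded. [folklore] -/
theorem isBounded_annulus (ρ η : ℝ) : Bornology.IsBounded (annulus ρ η) :=
  (isBounded_ball (x := (0 : ℂ)) (r := ρ + η)).subset fun _ hz => mem_ball_zero_iff.2 hz.2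

/-- **If an open set contains a circle it contains a closed annulus around it.** [folklore] -/
theorem exists_annulus_subset {W : Set ℂ} (hW : IsOpen W) {ρ : ℝ} (hρ : 0 < ρ) (h : sphere (0 : ℂ) ρ ⊆ W) :
    ∃ η, 0 < η ∧ η < ρ ∧ {z : ℂ | ρ - η ≤ ‖z‖ ∧ ‖z‖ ≤ ρ + η} ⊆ W := by
  obtain ⟨δ, hδ, hthick⟩ := (isCompact_sphere (0 : ℂ) ρ).exists_cthickening_subset_open hW h
  refine ⟨min (δ / 2) (ρ / 2), lt_min (half_pos hδ) (half_pos hρ), by linarith [min_le_right (δ / 2) (ρ / 2)],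
    fun z hz => hthick ?_⟩
  have hz0 : z ≠ 0 := by
    intro h0; simp only [mem_setOf_eq, h0, norm_zero] at hz; linarith [hz.1, min_le_right (δ / 2) (ρ / 2)]
  -- the radial projection of `z` to the circle is `δ`-close
  refine mem_cthickening_of_dist_le z ((ρ : ℂ) * ((‖z‖ : ℂ)⁻¹ * z)) δ _ ?_ ?_
  · rw [mem_sphere_zero_iff_norm, norm_mul, norm_mul, norm_inv, Complex.norm_real, Complex.norm_real,
      Real.norm_eq_abs, Real.norm_eq_abs, abs_of_pos hρ, abs_of_nonneg (norm_nonneg z),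
      inv_mul_cancel₀ (norm_ne_zero_iff.2 hz0), mul_one]
  · have hnz : (‖z‖ : ℂ) ≠ 0 := by exact_mod_cast norm_ne_zero_iff.2 hz0
    have key : z - (ρ : ℂ) * ((‖z‖ : ℂ)⁻¹ * z) = ((‖z‖ - ρ : ℝ) : ℂ) * ((‖z‖ : ℂ)⁻¹ * z) := by
      push_cast; field_simp
    rw [dist_eq_norm, key, norm_mul, norm_mul, norm_inv, Complex.norm_real, Complex.norm_real, Real.norm_eq_abs,
      Real.norm_eq_abs, abs_of_nonneg (norm_nonneg z), inv_mul_cancel₀ (norm_ne_zero_iff.2 hz0), mul_one, abs_le]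
    constructor <;> linarith [hz.1, hz.2, min_le_left (δ / 2) (ρ / 2)]

/-! ### A proper Morse function on the exotic annulus and a regular level above the core circle -/

section Level

variable {ρ η : ℝ} (𝒮 : PlaneAtlas (annulus ρ η))

/-- The core circle `‖z‖ = ρ` lies in the annulus (`η > 0`). [folklore] -/
theorem sphere_subset_annulus (hη : 0 < η) : sphere (0 : ℂ) ρ ⊆ annulus ρ η := fun z hz => by
  rw [mem_sphere_zero_iff_norm] at hz; rw [mem_annulus, hz]; exact ⟨by linarith, by linarith⟩

/-- The core circle, as a subset of the exotic annulus `𝒮.Man`. [folklore] -/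
def core (𝒮 : PlaneAtlas (annulus ρ η)) : Set 𝒮.Man := 𝒮.val ⁻¹' sphere (0 : ℂ) ρ

/-- The image of the core is the circle. [folklore] -/
theorem image_val_core (hη : 0 < η) : 𝒮.val '' 𝒮.core = sphere (0 : ℂ) ρ := by
  rw [core, image_preimage_eq_inter_range, range_val, inter_eq_left]
  exact sphere_subset_annulus hη

/-- The core is compact. [folklore] -/
theorem isCompact_core (hη : 0 < η) : IsCompact 𝒮.core := by
  rw [𝒮.isEmbedding_val.isCompact_iff, image_val_core 𝒮 hη]
  exact isCompact_sphere 0 ρ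

/-- The core is connected (the circle is, `ℂ` having real dimension `2`; `ρ ≥ 0`). [folklore] -/
theorem isConnected_core (hη : 0 < η) (hρ : 0 ≤ ρ) : IsConnected 𝒮.core := by
  have hs : IsConnected (sphere (0 : ℂ) ρ) :=
    isConnected_sphere (by rw [Complex.rank_real_complex]; norm_num) 0 hρ
  refine ⟨?_, (𝒮.isEmbedding_val.isInducing.isPreconnected_image).1 ?_⟩
  · obtain ⟨z, hz⟩ := hs.nonempty
    exact ⟨𝒮.mk z (sphere_subset_annulus hη hz), hz⟩
  · rw [image_val_core 𝒮 hη]; exact hs.isPreconnected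

end Level

end PlaneAtlas

end Literature.Topology.FourManifolds

end


noncomputable section

namespace Literature.Topology.FourManifolds

open _root_.Set _root_.Metric _root_.OpenPartialHomeomorph _root_.Filter
open scoped _root_.Manifold _root_.Topology _root_.ContDiff
open Literature.Geometry.Manifold (AtlasOn)
open Literature.Geometry.Manifold.AtlasOn
open Literature.Topology.PlaneTopology.CircleTwist (turn norm_turn exists_turn_eq)

/-- Local notation for the model plane `ℝ²`. -/
local notation "𝔼₂" => EuclideanSpace ℝ (Fin 2)

namespace PlaneAtlas

section Level

variable {ρ η : ℝ} (𝒮 : PlaneAtlas (annulus ρ η))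

/-! ### Topology of the exotic annulus -/

/-- The annulus `{ρ - η < ‖z‖ < ρ + η}` (`0 ≤ ρ - η`) is connected: it is the polar image of a
rectangle. [folklore] -/
theorem isConnected_annulus (hρη : 0 ≤ ρ - η) (hη : 0 < η) : IsConnected (annulus ρ η) := by
  have hpol : Continuous fun p : ℝ × ℝ => (p.1 : ℂ) * turn p.2 :=
    (Complex.continuous_ofReal.comp continuous_fst).mul
      ((show Continuous turn by unfold Literature.Topology.PlaneTopology.CircleTwist.turn; fun_prop).comp continuous_snd)
  have himg : (fun p : ℝ × ℝ => (p.1 : ℂ) * turn p.2) '' (Ioo (ρ - η) (ρ + η) ×ˢ univ) = annulus ρ η := by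
    ext z
    constructor
    · rintro ⟨⟨r, t⟩, ⟨hr, -⟩, rfl⟩
      have hr0 : 0 ≤ r := hρη.trans hr.1.le
      rw [mem_annulus, norm_mul, Complex.norm_real, Real.norm_eq_abs, abs_of_nonneg hr0, norm_turn, mul_one]
      exact hr
    · intro hz
      have hz0 : 0 < ‖z‖ := lt_of_le_of_lt hρη hz.1
      obtain ⟨θ, -, hθ⟩ := exists_eq_polar_of_norm_eq hz0 rfl 0
      exact ⟨(‖z‖, θ), ⟨hz, mem_univ _⟩, hθ.symm⟩
  rw [← himg]
  exact ((isConnected_Ioo (by linarith)).prod isConnected_univ).image _ hpol.continuousOn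

/-- The exotic annulus is connected. [folklore] -/
theorem connectedSpace_man (hρη : 0 ≤ ρ - η) (hη : 0 < η) : ConnectedSpace 𝒮.Man := by
  rw [connectedSpace_iff_univ]
  have hc := isConnected_annulus hρη hη
  refine ⟨?_, (𝒮.isEmbedding_val.isInducing.isPreconnected_image).1 ?_⟩
  · obtain ⟨z, hz⟩ := hc.nonempty; exact ⟨𝒮.mk z hz, mem_univ _⟩
  · rw [image_univ, range_val]; exact hc.isPreconnected

/-- The exotic annulus is not compact (a compact open subset of `ℂ` would be clopen and
bounded). [folklore] -/
theorem noncompactSpace_man (hρη : 0 ≤ ρ - η) (hη : 0 < η) : NoncompactSpace 𝒮.Man := by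
  refine ⟨fun hK => ?_⟩
  have h1 : IsCompact (annulus ρ η) := by
    rw [← 𝒮.range_val, ← image_univ]; exact hK.image 𝒮.continuous_val
  rcases isClopen_iff.1 ⟨h1.isClosed, isOpen_annulus ρ η⟩ with h | h
  · exact (isConnected_annulus hρη hη).nonempty.ne_empty h
  · have := isBounded_annulus ρ η
    rw [h] at this
    exact NormedSpace.unbounded_univ ℝ ℂ this

/-- Sublevel sets of a function tending to `+∞` along the cocompact filter are compact.
[folklore] -/
theorem isCompact_preimage_Iic_of_tendsto {X : Type*} [TopologicalSpace X] {f : X → ℝ} (hf : Continuous f)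
    (hprop : Tendsto f (cocompact X) atTop) (b : ℝ) : IsCompact (f ⁻¹' Iic b) := by
  rw [(hasBasis_cocompact (X := X)).tendsto_iff atTop_basis] at hprop
  obtain ⟨K, hK, hKf⟩ := hprop (b + 1) trivial
  refine hK.of_isClosed_subset (isClosed_Iic.preimage hf) fun x hx => ?_
  by_contra hxK
  have h1 := hKf x hxK
  rw [mem_Ici] at h1
  have h2 : f x ≤ b := hx
  linarith

/-- **A regular level of a proper Morse function above the core circle.** On the exotic annulus
there are a Morse function `f` tending to `+∞` at infinity (`exists_isMorse_tendsto_cocompact_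
atTop_euclidean`) and a level `a` which exceeds `f` on the core circle, carries no critical point
(`exists_regularLevel_gt_of_isMorse`) and is nonempty (intermediate value theorem on the
connected non-compact annulus). [folklore] -/
theorem exists_regular_level (hρη : 0 ≤ ρ - η) (hη : 0 < η) :
    ∃ (f : 𝒮.Man → ℝ) (a : ℝ), IsMorse (𝓡 (1 + 1)) f ∧ Tendsto f (cocompact 𝒮.Man) atTop ∧ (∀ x ∈ 𝒮.core, f x < a) ∧
      (∀ x, f x = a → ¬ IsMCriticalPt (𝓡 (1 + 1)) f x) ∧ ∃ x, f x = a := by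
  obtain ⟨f, hf, -, hprop⟩ := exists_isMorse_tendsto_cocompact_atTop_euclidean (1 + 1) 𝒮.Man
  obtain ⟨b, hb⟩ : ∃ b, ∀ x ∈ 𝒮.core, f x ≤ b := by
    obtain ⟨b, hb⟩ := (isCompact_core 𝒮 hη).bddAbove_image hf.1.continuous.continuousOn
    exact ⟨b, fun x hx => hb (mem_image_of_mem f hx)⟩
  obtain ⟨c, hbc, -, hreg⟩ := exists_regularLevel_gt_of_isMorse hf hprop b
  refine ⟨f, c, hf, hprop, fun x hx => (hb x hx).trans_lt hbc, hreg, ?_⟩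
  haveI := 𝒮.connectedSpace_man hρη hη
  haveI := 𝒮.noncompactSpace_man hρη hη
  obtain ⟨x₀, hx₀⟩ := (isConnected_core 𝒮 hη (by linarith)).nonempty
  obtain ⟨x₁, hx₁⟩ : ∃ x₁, c ≤ f x₁ := (hprop.eventually (eventually_ge_atTop c)).exists
  obtain ⟨x, hx⟩ := intermediate_value_univ x₀ x₁ hf.1.continuous ⟨(hb x₀ hx₀).trans hbc.le, hx₁⟩
  exact ⟨x, hx⟩

/-- **Level data on the exotic annulus**: a proper Morse function and a nonempty regular level
above the core circle (non-vacuous by `exists_regular_level`). [folklore] -/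
structure LevelData (𝒮 : PlaneAtlas (annulus ρ η)) where
  /-- The Morse function. -/
  f : 𝒮.Man → ℝ
  /-- The level. -/
  a : ℝ
  /-- `f` is a Morse function. -/
  isMorse : IsMorse (𝓡 (1 + 1)) f
  /-- `f` is proper (tends to `+∞` at infinity). -/
  tendsto : Tendsto f (cocompact 𝒮.Man) atTop
  /-- The level exceeds `f` on the core circle. -/
  lt_of_mem_core : ∀ x ∈ 𝒮.core, f x < a
  /-- The level carries no critical point. -/
  not_isMCriticalPt : ∀ x, f x = a → ¬ IsMCriticalPt (𝓡 (1 + 1)) f x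
  /-- The level is nonempty. -/
  exists_eq : ∃ x, f x = a

/-- Level data exist (`0 ≤ ρ - η`, `0 < η`). [folklore] -/
theorem nonempty_levelData (hρη : 0 ≤ ρ - η) (hη : 0 < η) : Nonempty (LevelData 𝒮) := by
  obtain ⟨f, a, h1, h2, h3, h4, h5⟩ := 𝒮.exists_regular_level hρη hη
  exact ⟨⟨f, a, h1, h2, h3, h4, h5⟩⟩

namespace LevelData

variable {𝒮} (Λ : LevelData 𝒮)

/-- `f` is smooth. [folklore] -/
theorem contMDiff : ContMDiff (𝓡 (1 + 1)) 𝓘(ℝ, ℝ) ∞ Λ.f := Λ.isMorse.1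

/-- `f` is continuous. [folklore] -/
theorem continuous : Continuous Λ.f := Λ.contMDiff.continuous

/-- The level is a regular level in the sense of `RegularLevelSet.lean` (model `𝓡 (1 + 1)`).
[folklore] -/
theorem isRegularLevel : IsRegularLevel (𝓡 (1 + 1)) Λ.f Λ.a :=
  ⟨Λ.contMDiff, fun _ _ => BoundarylessManifold.isInteriorPoint, fun _ hx => Λ.not_isMCriticalPt _ hx⟩

/-- Sublevel sets are compact. [folklore] -/
theorem isCompact_preimage_Iic (b : ℝ) : IsCompact (Λ.f ⁻¹' Iic b) :=
  isCompact_preimage_Iic_of_tendsto Λ.continuous Λ.tendsto b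

/-- Closed bands are compact. [folklore] -/
theorem isCompact_preimage_Icc (b b' : ℝ) : IsCompact (Λ.f ⁻¹' Icc b b') :=
  (Λ.isCompact_preimage_Iic b').of_isClosed_subset (isClosed_Icc.preimage Λ.continuous)
    (preimage_mono Icc_subset_Iic_self)

/-- The level set is compact. [folklore] -/
theorem isCompact_level : IsCompact (Λ.f ⁻¹' {Λ.a}) :=
  (Λ.isCompact_preimage_Iic Λ.a).of_isClosed_subset (isClosed_singleton.preimage Λ.continuous)
    (preimage_mono (by simp))

/-- The level manifold is nonempty. [folklore] -/
instance : Nonempty (RegularLevel Λ.isRegularLevel) := by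
  obtain ⟨x, hx⟩ := Λ.exists_eq; exact ⟨⟨x, hx⟩⟩

/-- The level manifold is compact. [folklore] -/
instance : CompactSpace (RegularLevel Λ.isRegularLevel) := isCompact_iff_compactSpace.1 Λ.isCompact_level

/-- A compactly supported unit-speed field across the level exists (`RegularLevelCollarBand`).
[folklore] -/
theorem nonempty_bandUnitField : Nonempty (BandUnitField 1 Λ.f Λ.a) :=
  Λ.isRegularLevel.exists_bandUnitField one_pos (Λ.isCompact_preimage_Icc _ _)

end LevelData

end Level

end PlaneAtlas

end Literature.Topology.FourManifolds

end


noncomputable section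

namespace Literature.Topology.FourManifolds

open _root_.Set _root_.Metric _root_.OpenPartialHomeomorph _root_.Filter
open scoped _root_.Manifold _root_.Topology _root_.ContDiff
open Literature.Geometry.Manifold (AtlasOn)
open Literature.Geometry.Manifold.AtlasOn
open Literature.Probability.RandomPlanarGeometry (JordanDomain)
open Literature.Probability.RandomPlanarGeometry.JordanDomain
open Literature.Topology.PlaneTopology
open Literature.Topology.PlaneTopology.CircleTwist (turn norm_turn exists_turn_eq)

/-- Local notation for the model plane `ℝ²`. -/
local notation "𝔼₂" => EuclideanSpace ℝ (Fin 2)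

/-- Local notation: the unit circle in `ℝ²` with its manifold structure. -/
local notation "𝕊¹" => (Metric.sphere (0 : EuclideanSpace ℝ (Fin (1 + 1))) 1)

/-! ### Jordan domains: sides of a connected set, inessential domains in an annulus -/

/-- **A connected set missing a Jordan curve lies inside or outside it.** [folklore] -/
theorem _root_.Literature.Probability.RandomPlanarGeometry.JordanDomain.subset_or_subset_of_disjoint_frontier (D : JordanDomain) {S : Set ℂ} (hS : IsPreconnected S)
    (hSJ : Disjoint S (frontier D.carrier)) : S ⊆ D.carrier ∨ S ⊆ (closure D.carrier)ᶜ := by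
  refine hS.subset_or_subset D.isOpen isClosed_closure.isOpen_compl ?_ fun z hz => ?_
  · exact Set.disjoint_left.2 fun z hz hz' => hz' (subset_closure hz)
  · by_cases hzD : z ∈ D.carrier
    · exact Or.inl hzD
    · refine Or.inr fun hzc => Set.disjoint_left.1 hSJ hz ?_
      rw [frontier_eq_closure_inter_closure, D.isOpen.isClosed_compl.closure_eq]
      exact ⟨hzc, hzD⟩

/-- The inner domain and the outer domain of a Jordan curve are disjoint. [folklore] -/
theorem _root_.Literature.Probability.RandomPlanarGeometry.JordanDomain.disjoint_carrier_compl_closure (D : JordanDomain) : Disjoint D.carrier (closure D.carrier)ᶜ :=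
  Set.disjoint_left.2 fun _ hz hz' => hz' (subset_closure hz)

/-- The set `{R ≤ ‖z‖}` (`0 ≤ R`) is connected: it is the polar image of a half-strip. [folklore] -/
theorem isConnected_setOf_le_norm {R : ℝ} (hR : 0 ≤ R) : IsConnected {z : ℂ | R ≤ ‖z‖} := by
  have hpol : Continuous fun p : ℝ × ℝ => (p.1 : ℂ) * turn p.2 :=
    (Complex.continuous_ofReal.comp continuous_fst).mul
      ((show Continuous turn by unfold Literature.Topology.PlaneTopology.CircleTwist.turn; fun_prop).comp continuous_snd)
  have himg : (fun p : ℝ × ℝ => (p.1 : ℂ) * turn p.2) '' (Ici R ×ˢ univ) = {z : ℂ | R ≤ ‖z‖} := by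
    ext z
    constructor
    · rintro ⟨⟨r, t⟩, ⟨hr, -⟩, rfl⟩
      have hr0 : 0 ≤ r := hR.trans hr
      rw [mem_setOf_eq, norm_mul, Complex.norm_real, Real.norm_eq_abs, abs_of_nonneg hr0, norm_turn, mul_one]
      exact hr
    · intro hz
      rcases (hR.trans hz).eq_or_lt with h0 | hpos
      · refine ⟨(0, 0), ⟨?_, mem_univ _⟩, ?_⟩
        · show R ≤ 0; rw [h0]; exact hz
        · have : z = 0 := norm_eq_zero.1 h0.symm
          rw [this]; simp
      · obtain ⟨θ, -, hθ⟩ := exists_eq_polar_of_norm_eq hpos rfl 0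
        exact ⟨(‖z‖, θ), ⟨hz, mem_univ _⟩, hθ.symm⟩
  rw [← himg]
  exact ((isConnected_Ici).prod isConnected_univ).image _ hpol.continuousOn

/-- **An inessential Jordan domain in an annulus.** If the Jordan curve `∂D` lies in the open
annulus `{ρ - η < ‖z‖ < ρ + η}` (`0 ≤ ρ - η`) and the inner domain `D` does not contain `0`,
then the inner disc `{‖z‖ ≤ ρ - η}` and the outer region `{ρ + η ≤ ‖z‖}` lie outside `D`, and
`closure D` lies in the annulus. [folklore] -/
theorem _root_.Literature.Probability.RandomPlanarGeometry.JordanDomain.closure_subset_annulus_of_zero_notMem (D : JordanDomain) {ρ η : ℝ} (hρη : 0 ≤ ρ - η)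
    (hη : 0 < η) (hJ : frontier D.carrier ⊆ PlaneAtlas.annulus ρ η) (h0 : (0 : ℂ) ∉ D.carrier) :
    closedBall (0 : ℂ) (ρ - η) ⊆ (closure D.carrier)ᶜ ∧ {z : ℂ | ρ + η ≤ ‖z‖} ⊆ (closure D.carrier)ᶜ ∧
      closure D.carrier ⊆ PlaneAtlas.annulus ρ η := by
  have h1 : closedBall (0 : ℂ) (ρ - η) ⊆ (closure D.carrier)ᶜ := by
    rcases D.subset_or_subset_of_disjoint_frontier (convex_closedBall (0 : ℂ) (ρ - η)).isPreconnected
      (Set.disjoint_left.2 fun z hz hz' => by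
        have := (hJ hz').1; rw [mem_closedBall_zero_iff] at hz; linarith) with h | h
    · exact absurd (h (mem_closedBall_self hρη)) h0
    · exact h
  have h2 : {z : ℂ | ρ + η ≤ ‖z‖} ⊆ (closure D.carrier)ᶜ := by
    rcases D.subset_or_subset_of_disjoint_frontier (isConnected_setOf_le_norm (by linarith : (0 : ℝ) ≤ ρ + η)).isPreconnected
      (Set.disjoint_left.2 fun z hz hz' => by have := (hJ hz').2; simp only [mem_setOf_eq] at hz; linarith) with h | h
    · exfalso
      -- `D` is bounded, the outer region is not
      obtain ⟨R, hR⟩ := D.isBounded.subset_ball 0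
      have hpos : 0 ≤ max R (ρ + η) + 1 := by linarith [le_max_right R (ρ + η)]
      have hmem : ((max R (ρ + η) + 1 : ℝ) : ℂ) ∈ {z : ℂ | ρ + η ≤ ‖z‖} := by
        simp only [mem_setOf_eq, Complex.norm_real, Real.norm_eq_abs]
        rw [abs_of_nonneg hpos]
        linarith [le_max_right R (ρ + η)]
      have := hR (h hmem)
      rw [mem_ball_zero_iff, Complex.norm_real, Real.norm_eq_abs, abs_of_nonneg hpos] at this
      linarith [le_max_left R (ρ + η)]
    · exact h
  refine ⟨h1, h2, fun z hz => ?_⟩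
  rw [PlaneAtlas.mem_annulus]
  constructor
  · by_contra hle; push Not at hle
    exact h1 (mem_closedBall_zero_iff.2 hle) hz
  · by_contra hle; push Not at hle
    exact h2 hle hz

namespace PlaneAtlas

namespace LevelData

variable {ρ η : ℝ} {𝒮 : PlaneAtlas (annulus ρ η)} (Λ : LevelData 𝒮)

/-! ### The components of the level as Jordan curves -/

/-- The level manifold (a compact `1`-manifold without boundary). [folklore] -/
abbrev Lv : Type := RegularLevel Λ.isRegularLevel

/-- The inclusion of the level into the exotic annulus. [folklore] -/
abbrev incl : Λ.Lv → 𝒮.Man := RegularLevel.incl Λ.isRegularLevel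

/-- The level manifold is locally connected. [folklore] -/
instance : LocallyConnectedSpace Λ.Lv := ChartedSpace.locallyConnectedSpace (EuclideanSpace ℝ (Fin 1)) Λ.Lv

/-- Components of the level are compact. [folklore] -/
theorem isCompact_connectedComponent (y : Λ.Lv) : IsCompact (connectedComponent y) :=
  isClosed_connectedComponent.isCompact

/-- **Each component of the level is a smoothly embedded circle** (classification of compact
`1`-manifolds, `PlaneLevelCircles.exists_isSmoothEmbedding_range_eq_of_opens`). [folklore] -/
theorem exists_circle (y : Λ.Lv) : ∃ γ : 𝕊¹ → 𝒮.Man,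
    Manifold.IsSmoothEmbedding (𝓡 1) (𝓡 (1 + 1)) ∞ γ ∧ range γ = Λ.incl '' connectedComponent y :=
  PlaneLevelCircles.exists_isSmoothEmbedding_range_eq_of_opens (RegularLevel.isSmoothEmbedding_incl Λ.isRegularLevel)
    ⟨connectedComponent y, isOpen_connectedComponent⟩ isConnected_connectedComponent (Λ.isCompact_connectedComponent y)

/-- The planar curve of the component of the level through `y`. [folklore] -/
def curve (y : Λ.Lv) : Set ℂ := 𝒮.val '' (Λ.incl '' connectedComponent y)

/-- The curve only depends on the component. [folklore] -/
theorem curve_eq_of_mem {y y' : Λ.Lv} (h : y' ∈ connectedComponent y) : Λ.curve y' = Λ.curve y := by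
  rw [curve, curve, connectedComponent_eq h]

/-- The curve lies in the annulus. [folklore] -/
theorem curve_subset_annulus (y : Λ.Lv) : Λ.curve y ⊆ annulus ρ η := by
  rintro _ ⟨x, -, rfl⟩; exact 𝒮.val_mem x

/-- The curve lies over the level. [folklore] -/
theorem apply_eq_of_mem_curve {y : Λ.Lv} {x : 𝒮.Man} (hx : 𝒮.val x ∈ Λ.curve y) : Λ.f x = Λ.a := by
  obtain ⟨x', ⟨y', -, rfl⟩, hxx'⟩ := hx
  rw [← 𝒮.val_injective hxx']
  exact y'.2

/-- `circlePoint` is injective on `[0, 2π)`. [folklore] -/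
theorem injOn_circlePoint : InjOn circlePoint (Ico 0 (2 * Real.pi)) := by
  intro a ha b hb hab
  obtain ⟨k, hk⟩ := circlePoint_eq_circlePoint_iff.1 hab
  have h1 : |a - b| < 2 * Real.pi := by rw [abs_lt]; constructor <;> linarith [ha.1, ha.2, hb.1, hb.2]
  rw [hk, abs_mul, abs_of_pos Real.two_pi_pos] at h1
  have h2 : |(k : ℝ)| < 1 := by
    by_contra hle; push Not at hle; nlinarith [Real.pi_pos]
  have hk0 : k = 0 := by
    have h3 : |k| < 1 := by exact_mod_cast h2
    rw [abs_lt] at h3; omega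
  rw [hk0, Int.cast_zero, mul_zero, sub_eq_zero] at hk
  exact hk

/-- **The components of the level are Jordan curves** (homeomorphic to `ℝ/ℤ`). [folklore] -/
theorem nonempty_homeomorph_curve (y : Λ.Lv) : Nonempty (AddCircle (1 : ℝ) ≃ₜ Λ.curve y) := by
  obtain ⟨γ, hγ, hrange⟩ := Λ.exists_circle y
  -- the loop `t ↦ val (γ (circlePoint (2πt)))`
  set ℓ : ℝ → ℂ := fun t => 𝒮.val (γ (circlePoint (2 * Real.pi * t))) with hℓ
  have hℓc : Continuous ℓ :=
    𝒮.continuous_val.comp (hγ.isEmbedding.continuous.comp (continuous_circlePoint.comp (continuous_const.mul continuous_id)))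
  have hℓp : Function.Periodic ℓ 1 := fun t => by
    simp only [hℓ, mul_add, mul_one]; rw [circlePoint_add_two_pi]
  have hℓi : InjOn ℓ (Ico 0 1) := by
    intro s hs t ht hst
    have h1 := hγ.isEmbedding.injective (𝒮.val_injective hst)
    have h2 := injOn_circlePoint ⟨by nlinarith [Real.pi_pos, hs.1], by nlinarith [Real.pi_pos, hs.2]⟩
      ⟨by nlinarith [Real.pi_pos, ht.1], by nlinarith [Real.pi_pos, ht.2]⟩ h1
    nlinarith [Real.pi_pos]
  have hrangeℓ : range ℓ = Λ.curve y := by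
    rw [curve, ← hrange, ← range_comp]
    ext z
    constructor
    · rintro ⟨t, rfl⟩; exact ⟨circlePoint (2 * Real.pi * t), rfl⟩
    · rintro ⟨u, rfl⟩
      obtain ⟨θ, rfl⟩ := circlePoint_surjective u
      refine ⟨θ / (2 * Real.pi), ?_⟩
      simp only [hℓ, Function.comp_apply]
      rw [mul_div_cancel₀ θ Real.two_pi_pos.ne']
  obtain ⟨e, -⟩ := exists_homeomorph_addCircle_forall_eq hℓc hℓp hℓi
  rw [hrangeℓ] at e
  exact ⟨e⟩

/-- **The inner domain of a component of the level**: the Jordan domain bounded by its curve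
(Jordan curve theorem). [folklore] -/
def dom (y : Λ.Lv) : JordanDomain := (exists_jordanDomain_frontier_eq (Λ.nonempty_homeomorph_curve y)).choose

/-- The frontier of the inner domain is the curve. [folklore] -/
theorem frontier_dom (y : Λ.Lv) : frontier (Λ.dom y).carrier = Λ.curve y :=
  (exists_jordanDomain_frontier_eq (Λ.nonempty_homeomorph_curve y)).choose_spec

/-- The inner domain only depends on the component (as a set). [folklore] -/
theorem dom_carrier_eq_of_mem {y y' : Λ.Lv} (h : y' ∈ connectedComponent y) :
    (Λ.dom y').carrier = (Λ.dom y).carrier :=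
  (Λ.dom y).carrier_eq_of_frontier_eq' (Λ.dom y').isOpen (Λ.dom y').isBounded (Λ.dom y').isConnected
    (by rw [frontier_dom, frontier_dom, Λ.curve_eq_of_mem h])

/-- A component is **essential** when its inner domain contains the origin. [folklore] -/
def Essential (y : Λ.Lv) : Prop := (0 : ℂ) ∈ (Λ.dom y).carrier

end LevelData

end PlaneAtlas

end Literature.Topology.FourManifolds

end


noncomputable section

namespace Literature.Topology.FourManifolds

open _root_.Set _root_.Metric _root_.OpenPartialHomeomorph _root_.Filter
open scoped _root_.Manifold _root_.Topology _root_.ContDiff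
open Literature.Geometry.Manifold (AtlasOn)
open Literature.Geometry.Manifold.AtlasOn
open Literature.Probability.RandomPlanarGeometry (JordanDomain)
open Literature.Probability.RandomPlanarGeometry.JordanDomain
open Literature.Topology.PlaneTopology

/-- Local notation for the model plane `ℝ²`. -/
local notation "𝔼₂" => EuclideanSpace ℝ (Fin 2)

namespace PlaneAtlas

namespace LevelData

variable {ρ η : ℝ} {𝒮 : PlaneAtlas (annulus ρ η)} (Λ : LevelData 𝒮) (U : BandUnitField 1 Λ.f Λ.a)

/-! ### Tubes around the components of the level (from the product chart) -/

/-- The product chart of the level (`RegularLevelCollarBand`). [folklore] -/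
abbrev Φ : OpenPartialHomeomorph (Λ.Lv × ℝ) 𝒮.Man := U.collarChart Λ.isRegularLevel

/-- The **tube** around the component of the level through `y`: the flow-out of the component
for times in `(-δ, δ)`. [folklore] -/
def tube (y : Λ.Lv) : Set 𝒮.Man := Λ.Φ U '' (connectedComponent y ×ˢ Ioo (-U.δ) U.δ)

/-- The lower half-tube (times in `(-δ, 0)`). [folklore] -/
def tubeNeg (y : Λ.Lv) : Set 𝒮.Man := Λ.Φ U '' (connectedComponent y ×ˢ Ioo (-U.δ) 0)

/-- The upper half-tube (times in `(0, δ)`). [folklore] -/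
def tubePos (y : Λ.Lv) : Set 𝒮.Man := Λ.Φ U '' (connectedComponent y ×ˢ Ioo 0 U.δ)

/-- The tube only depends on the component. [folklore] -/
theorem tube_eq_of_mem {y y' : Λ.Lv} (h : y' ∈ connectedComponent y) : Λ.tube U y' = Λ.tube U y := by
  rw [tube, tube, connectedComponent_eq h]

/-- The lower half-tube only depends on the component. [folklore] -/
theorem tubeNeg_eq_of_mem {y y' : Λ.Lv} (h : y' ∈ connectedComponent y) : Λ.tubeNeg U y' = Λ.tubeNeg U y := by
  rw [tubeNeg, tubeNeg, connectedComponent_eq h]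

/-- The upper half-tube only depends on the component. [folklore] -/
theorem tubePos_eq_of_mem {y y' : Λ.Lv} (h : y' ∈ connectedComponent y) : Λ.tubePos U y' = Λ.tubePos U y := by
  rw [tubePos, tubePos, connectedComponent_eq h]

/-- The tube is open. [folklore] -/
theorem isOpen_tube (y : Λ.Lv) : IsOpen (Λ.tube U y) :=
  (Λ.Φ U).isOpen_image_of_subset_source (isOpen_connectedComponent.prod isOpen_Ioo)
    (by rw [BandUnitField.collarChart_source]; exact prod_mono (subset_univ _) Subset.rfl)

/-- The component lies in its tube (time `0`). [folklore] -/
theorem incl_mem_tube {y y' : Λ.Lv} (h : y' ∈ connectedComponent y) : Λ.incl y' ∈ Λ.tube U y :=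
  ⟨(y', 0), ⟨h, by simpa using U.δ_pos⟩, by rw [BandUnitField.collarChart_apply]; exact U.fl_zero _⟩

/-- `f < a` on the lower half-tube. [folklore] -/
theorem apply_lt_of_mem_tubeNeg {y : Λ.Lv} {x : 𝒮.Man} (hx : x ∈ Λ.tubeNeg U y) : Λ.f x < Λ.a := by
  obtain ⟨⟨y', s⟩, ⟨-, hs⟩, rfl⟩ := hx
  have := U.apply_collarChart Λ.isRegularLevel (p := (y', s)) ⟨mem_univ _, ⟨hs.1, hs.2.trans U.δ_pos⟩⟩
  rw [this]; linarith [hs.2]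

/-- `f > a` on the upper half-tube. [folklore] -/
theorem lt_apply_of_mem_tubePos {y : Λ.Lv} {x : 𝒮.Man} (hx : x ∈ Λ.tubePos U y) : Λ.a < Λ.f x := by
  obtain ⟨⟨y', s⟩, ⟨-, hs⟩, rfl⟩ := hx
  have := U.apply_collarChart Λ.isRegularLevel (p := (y', s)) ⟨mem_univ _, ⟨(neg_neg_iff_pos.2 U.δ_pos).trans hs.1, hs.2⟩⟩
  rw [this]; linarith [hs.1]

/-- The tube is the lower half-tube, the component and the upper half-tube. [folklore] -/
theorem tube_subset (y : Λ.Lv) : Λ.tube U y ⊆ Λ.tubeNeg U y ∪ Λ.incl '' connectedComponent y ∪ Λ.tubePos U y := by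
  rintro _ ⟨⟨y', s⟩, ⟨hy', hs⟩, rfl⟩
  rcases lt_trichotomy s 0 with h | rfl | h
  · exact Or.inl (Or.inl ⟨(y', s), ⟨hy', hs.1, h⟩, rfl⟩)
  · refine Or.inl (Or.inr ⟨y', hy', ?_⟩)
    rw [BandUnitField.collarChart_apply]; exact (U.fl_zero _).symm
  · exact Or.inr ⟨(y', s), ⟨hy', h, hs.2⟩, rfl⟩

/-- The lower half-tube is connected. [folklore] -/
theorem isConnected_tubeNeg (y : Λ.Lv) : IsConnected (Λ.tubeNeg U y) :=
  (isConnected_connectedComponent.prod (isConnected_Ioo (neg_neg_iff_pos.2 U.δ_pos))).image _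
    ((Λ.Φ U).continuousOn.mono (by
      rw [BandUnitField.collarChart_source]
      exact prod_mono (subset_univ _) (Ioo_subset_Ioo_right U.δ_pos.le)))

/-- The upper half-tube is connected. [folklore] -/
theorem isConnected_tubePos (y : Λ.Lv) : IsConnected (Λ.tubePos U y) :=
  (isConnected_connectedComponent.prod (isConnected_Ioo U.δ_pos)).image _
    ((Λ.Φ U).continuousOn.mono (by
      rw [BandUnitField.collarChart_source]
      exact prod_mono (subset_univ _) (Ioo_subset_Ioo_left (neg_neg_iff_pos.2 U.δ_pos).le)))

/-- The lower half-tube lies in its tube. [folklore] -/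
theorem tubeNeg_subset_tube (y : Λ.Lv) : Λ.tubeNeg U y ⊆ Λ.tube U y :=
  image_mono (prod_mono Subset.rfl (Ioo_subset_Ioo_right U.δ_pos.le))

/-- The upper half-tube lies in its tube. [folklore] -/
theorem tubePos_subset_tube (y : Λ.Lv) : Λ.tubePos U y ⊆ Λ.tube U y :=
  image_mono (prod_mono Subset.rfl (Ioo_subset_Ioo_left (neg_neg_iff_pos.2 U.δ_pos).le))

/-- The planar image of the upper half-tube misses the curve of the component. [folklore] -/
theorem disjoint_val_tubePos_curve (y : Λ.Lv) : Disjoint (𝒮.val '' Λ.tubePos U y) (Λ.curve y) := by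
  refine Set.disjoint_left.2 ?_
  rintro _ ⟨x, hx, rfl⟩ hx'
  have h1 := Λ.lt_apply_of_mem_tubePos U hx
  rw [Λ.apply_eq_of_mem_curve hx'] at h1
  exact lt_irrefl _ h1

/-! ### The sublevel component of the core circle -/

/-- The strict sublevel set `{f < a}`. [folklore] -/
def subl : Set 𝒮.Man := {x | Λ.f x < Λ.a}

/-- The strict sublevel set is open. [folklore] -/
theorem isOpen_subl : IsOpen Λ.subl := isOpen_lt Λ.continuous continuous_const

/-- A component of the strict sublevel set is relatively compact. [folklore] -/
theorem isCompact_closure_ccIn (x₀ : 𝒮.Man) : IsCompact (closure (connectedComponentIn Λ.subl x₀)) :=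
  (Λ.isCompact_preimage_Iic Λ.a).of_isClosed_subset isClosed_closure
    (closure_minimal ((connectedComponentIn_subset _ _).trans fun _ hx => show Λ.f _ ≤ Λ.a from le_of_lt hx)
      (isClosed_Iic.preimage Λ.continuous))

/-- **The closure of a component of `{f < a}` adds only points of the level.** [folklore] -/
theorem closure_ccIn_subset (x₀ : 𝒮.Man) :
    closure (connectedComponentIn Λ.subl x₀) ⊆ connectedComponentIn Λ.subl x₀ ∪ Λ.f ⁻¹' {Λ.a} := by
  intro x hx
  have hle : Λ.f x ≤ Λ.a :=
    closure_minimal (t := Λ.f ⁻¹' Iic Λ.a) ((connectedComponentIn_subset _ _).trans fun _ hx => show Λ.f _ ≤ Λ.a from le_of_lt hx)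
      (isClosed_Iic.preimage Λ.continuous) hx
  rcases hle.lt_or_eq with hlt | heq
  · left
    set B := connectedComponentIn Λ.subl x with hB
    have hBo : IsOpen B := Λ.isOpen_subl.connectedComponentIn
    have hxB : x ∈ B := mem_connectedComponentIn hlt
    obtain ⟨z, hzB, hzP⟩ := mem_closure_iff_nhds.1 hx B (hBo.mem_nhds hxB)
    rw [connectedComponentIn_eq hzP, ← connectedComponentIn_eq hzB]
    exact hxB
  · exact Or.inr heq

/-- The planar closure of a component of `{f < a}` is covered by the planar image of its closure.
[folklore] -/
theorem closure_val_image_ccIn_subset (x₀ : 𝒮.Man) :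
    closure (𝒮.val '' connectedComponentIn Λ.subl x₀) ⊆ 𝒮.val '' closure (connectedComponentIn Λ.subl x₀) :=
  closure_minimal (image_mono subset_closure) ((Λ.isCompact_closure_ccIn x₀).image 𝒮.continuous_val).isClosed

/-- **A tube meeting a component of `{f < a}` has its lower half inside it.** [folklore] -/
theorem tubeNeg_subset_of_meets {y : Λ.Lv} {x₀ : 𝒮.Man} (hmeet : (Λ.tube U y ∩ connectedComponentIn Λ.subl x₀).Nonempty) :
    Λ.tubeNeg U y ⊆ connectedComponentIn Λ.subl x₀ := by
  obtain ⟨x, hxt, hxP⟩ := hmeet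
  have hxlt : Λ.f x < Λ.a := connectedComponentIn_subset Λ.subl x₀ hxP
  have hxneg : x ∈ Λ.tubeNeg U y := by
    rcases Λ.tube_subset U y hxt with (h | ⟨y', -, rfl⟩) | h
    · exact h
    · exact absurd (show Λ.f (Λ.incl y') = Λ.a from y'.2) hxlt.ne
    · exact absurd hxlt (not_lt.2 (Λ.lt_apply_of_mem_tubePos U h).le)
  have h1 : Λ.tubeNeg U y ⊆ connectedComponentIn Λ.subl x :=
    (Λ.isConnected_tubeNeg U y).isPreconnected.subset_connectedComponentIn hxneg fun z hz => Λ.apply_lt_of_mem_tubeNeg U hz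
  rwa [← connectedComponentIn_eq hxP] at h1

/-- Finitely many points represent all components of the (compact) level. [folklore] -/
theorem exists_finset_components : ∃ t : Finset Λ.Lv, ∀ y, ∃ y₀ ∈ t, y ∈ connectedComponent y₀ := by
  obtain ⟨t, ht⟩ := isCompact_univ.elim_finite_subcover (fun y : Λ.Lv => connectedComponent y)
    (fun _ => isOpen_connectedComponent) fun y _ => mem_iUnion.2 ⟨y, mem_connectedComponent⟩
  exact ⟨t, fun y => by simpa using ht (mem_univ y)⟩

/-! ### An essential component exists -/

/-- **Two-sidedness**: if the planar image of a component `P` of `{f < a}` lies outside the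
inner domain of a level component whose tube meets `P`, then the upper half-tube lies inside
that inner domain (the tube is a neighbourhood of the curve, which is the frontier of the inner
domain). [folklore] -/
theorem val_tubePos_subset_dom {y : Λ.Lv} {x₀ : 𝒮.Man}
    (hmeet : (Λ.tube U y ∩ connectedComponentIn Λ.subl x₀).Nonempty)
    (hout : 𝒮.val '' connectedComponentIn Λ.subl x₀ ⊆ (closure (Λ.dom y).carrier)ᶜ) :
    𝒮.val '' Λ.tubePos U y ⊆ (Λ.dom y).carrier := by
  have hdisj := Λ.disjoint_val_tubePos_curve U y
  rw [← Λ.frontier_dom y] at hdisj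
  rcases (Λ.dom y).subset_or_subset_of_disjoint_frontier
    (((Λ.isConnected_tubePos U y).image _ 𝒮.continuous_val.continuousOn).isPreconnected) hdisj with h | h
  · exact h
  · exfalso
    -- the tube is a planar neighbourhood of the point `val (incl y)` of the curve = frontier of `dom y`
    have hp : 𝒮.val (Λ.incl y) ∈ frontier (Λ.dom y).carrier := by
      rw [Λ.frontier_dom y]; exact ⟨Λ.incl y, ⟨y, mem_connectedComponent, rfl⟩, rfl⟩
    have hN : 𝒮.val '' Λ.tube U y ∈ 𝓝 (𝒮.val (Λ.incl y)) :=
      (𝒮.isOpenMap_val _ (Λ.isOpen_tube U y)).mem_nhds ⟨Λ.incl y, Λ.incl_mem_tube U mem_connectedComponent, rfl⟩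
    have hcl : 𝒮.val (Λ.incl y) ∈ closure (Λ.dom y).carrier := frontier_subset_closure hp
    obtain ⟨q, hqN, hqD⟩ := mem_closure_iff_nhds.1 hcl _ hN
    obtain ⟨x, hx, rfl⟩ := hqN
    have hneg := Λ.tubeNeg_subset_of_meets U hmeet
    rcases Λ.tube_subset U y hx with (h' | ⟨y', hy', rfl⟩) | h'
    · exact hout ⟨x, hneg h', rfl⟩ (subset_closure hqD)
    · -- points of the curve are not in the (open) inner domain
      have : 𝒮.val (Λ.incl y') ∈ frontier (Λ.dom y).carrier := by
        rw [Λ.frontier_dom y]; exact ⟨Λ.incl y', ⟨y', hy', rfl⟩, rfl⟩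
      rw [frontier_eq_closure_inter_closure] at this
      exact (interior_maximal Subset.rfl (Λ.dom y).isOpen |> fun hh => this.2) |> fun hc =>
        (by rw [(Λ.dom y).isOpen.isClosed_compl.closure_eq] at hc; exact hc hqD)
    · exact h ⟨x, h', rfl⟩ (subset_closure hqD)

end LevelData

end PlaneAtlas

end Literature.Topology.FourManifolds

end


noncomputable section

namespace Literature.Topology.FourManifolds

open _root_.Set _root_.Metric _root_.OpenPartialHomeomorph _root_.Filter
open scoped _root_.Manifold _root_.Topology _root_.ContDiff
open Literature.Geometry.Manifold (AtlasOn)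
open Literature.Geometry.Manifold.AtlasOn
open Literature.Probability.RandomPlanarGeometry (JordanDomain)
open Literature.Probability.RandomPlanarGeometry.JordanDomain
open Literature.Topology.PlaneTopology

/-- Local notation for the model plane `ℝ²`. -/
local notation "𝔼₂" => EuclideanSpace ℝ (Fin 2)

namespace PlaneAtlas

namespace LevelData

variable {ρ η : ℝ} {𝒮 : PlaneAtlas (annulus ρ η)} (Λ : LevelData 𝒮)

/-- **An essential level component exists.** On the exotic annulus `{ρ - η < ‖z‖ < ρ + η}`
(`0 ≤ ρ - η`, `0 < η`), some component of the regular level `f⁻¹(a)` above the core circle is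
a Jordan curve whose inner domain contains `0` (i.e. it separates the two ends of the annulus).

Proof. Let `P` be the component of `{f < a}` containing the core circle and suppose every level
component is inessential. If the planar image of `P` lay inside the inner domain `D` of some
level component, the outer domain of `D` — connected, containing the inner disc
`{‖z‖ ≤ ρ - η}` and the outer region `{ρ + η ≤ ‖z‖}` — would contain a point of the core
circle `⊆ P ⊆ D`, absurd. So it lies outside every inner domain, and then
`T = val(P) ∪ ⋃ closure D_Q` (over the finitely many level components `Q` whose tube meets
`P`) is closed (the closure of `P` adds only level points, which lie on such curves), open
(near a curve point the tube is `lower half ⊆ P`, the curve, and `upper half ⊆ D_Q` by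
two-sidedness), nonempty and inside the annulus, contradicting the connectedness of `ℂ`.
[folklore] -/
theorem exists_essential (hρη : 0 ≤ ρ - η) (hη : 0 < η) : ∃ y : Λ.Lv, Λ.Essential y := by
  classical
  by_contra hall
  push Not at hall
  obtain ⟨U⟩ := Λ.nonempty_bandUnitField
  -- the component `P` of `{f < a}` containing the core
  obtain ⟨x₀, hx₀⟩ := (isConnected_core 𝒮 hη (by linarith)).nonempty
  set P : Set 𝒮.Man := connectedComponentIn Λ.subl x₀ with hP
  have hcoreP : 𝒮.core ⊆ P :=
    (isConnected_core 𝒮 hη (by linarith)).isPreconnected.subset_connectedComponentIn hx₀ fun x hx => Λ.lt_of_mem_core x hx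
  have hPsubl : P ⊆ Λ.subl := connectedComponentIn_subset _ _
  have hPconn : IsPreconnected (𝒮.val '' P) :=
    (isPreconnected_connectedComponentIn).image _ 𝒮.continuous_val.continuousOn
  have hsphere : sphere (0 : ℂ) ρ ⊆ 𝒮.val '' P := by
    rw [← image_val_core 𝒮 hη]; exact image_mono hcoreP
  -- facts about the (inessential) inner domains
  have hdomJ : ∀ y, frontier (Λ.dom y).carrier ⊆ annulus ρ η := fun y => by
    rw [Λ.frontier_dom y]; exact Λ.curve_subset_annulus y
  have hG2 := fun y => (Λ.dom y).closure_subset_annulus_of_zero_notMem hρη hη (hdomJ y) (hall y)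
  have hPdisj : ∀ y, Disjoint (𝒮.val '' P) (frontier (Λ.dom y).carrier) := fun y => by
    rw [Λ.frontier_dom y]
    refine Set.disjoint_left.2 ?_
    rintro _ ⟨x, hx, rfl⟩ hx'
    exact (hPsubl hx).ne (Λ.apply_eq_of_mem_curve hx')
  -- `val(P)` lies outside every inner domain
  have hout : ∀ y, 𝒮.val '' P ⊆ (closure (Λ.dom y).carrier)ᶜ := by
    intro y
    rcases (Λ.dom y).subset_or_subset_of_disjoint_frontier hPconn (hPdisj y) with h | h
    · exfalso
      -- the outer domain is connected, contains `0` and points of norm `ρ + η`, hence a core point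
      obtain ⟨hE, -, -⟩ := (Λ.dom y).exterior_of_JCT JordanCurveTheorem_holds
      have h0E : (0 : ℂ) ∈ (closure (Λ.dom y).carrier)ᶜ := (hG2 y).1 (mem_closedBall_self hρη)
      have hwE : ((ρ + η : ℝ) : ℂ) ∈ (closure (Λ.dom y).carrier)ᶜ := (hG2 y).2.1 (by
        simp only [mem_setOf_eq, Complex.norm_real, Real.norm_eq_abs]; rw [abs_of_nonneg (by linarith)])
      have hIVT := hE.isPreconnected.intermediate_value h0E hwE continuous_norm.continuousOn
      have hρmem : ρ ∈ Icc ‖(0 : ℂ)‖ ‖((ρ + η : ℝ) : ℂ)‖ := by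
        rw [norm_zero, Complex.norm_real, Real.norm_eq_abs, abs_of_nonneg (by linarith)]
        exact ⟨by linarith, by linarith⟩
      obtain ⟨z, hzE, hzρ⟩ := hIVT hρmem
      have hzP : z ∈ 𝒮.val '' P := hsphere (mem_sphere_zero_iff_norm.2 hzρ)
      exact hzE (subset_closure (h hzP))
    · exact h
  -- finitely many representatives of the level components; those whose tube meets `P`
  obtain ⟨t, ht⟩ := Λ.exists_finset_components
  set I : Set Λ.Lv := {y | y ∈ t ∧ (Λ.tube U y ∩ P).Nonempty} with hI
  have hIfin : I.Finite := t.finite_toSet.subset fun y hy => hy.1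
  set T : Set ℂ := 𝒮.val '' P ∪ ⋃ y ∈ I, closure (Λ.dom y).carrier with hT
  -- `T` lies in the annulus
  have hTann : T ⊆ annulus ρ η := by
    rintro z (⟨x, -, rfl⟩ | hz)
    · exact 𝒮.val_mem x
    · obtain ⟨y, -, hzy⟩ := mem_iUnion₂.1 hz
      exact (hG2 y).2.2 hzy
  -- `T` is closed
  have hTcl : IsClosed T := by
    have hcl : closure (𝒮.val '' P) ⊆ T := by
      refine (Λ.closure_val_image_ccIn_subset x₀).trans ?_
      rintro _ ⟨x, hx, rfl⟩
      rcases Λ.closure_ccIn_subset x₀ hx with hxP | hxa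
      · exact Or.inl ⟨x, hxP, rfl⟩
      · -- a level point in the closure of `P`: its component's tube meets `P`
        set y : Λ.Lv := ⟨x, hxa⟩ with hy
        obtain ⟨y₀, hy₀t, hyy₀⟩ := ht y
        have hmeet : (Λ.tube U y₀ ∩ P).Nonempty := by
          rw [← Λ.tube_eq_of_mem U hyy₀]
          exact mem_closure_iff_nhds.1 hx _ ((Λ.isOpen_tube U y).mem_nhds (Λ.incl_mem_tube U mem_connectedComponent))
        refine Or.inr (mem_iUnion₂.2 ⟨y₀, ⟨hy₀t, hmeet⟩, ?_⟩)
        refine frontier_subset_closure ?_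
        rw [Λ.frontier_dom y₀, ← Λ.curve_eq_of_mem hyy₀]
        exact ⟨Λ.incl y, ⟨y, mem_connectedComponent, rfl⟩, rfl⟩
    rw [← closure_subset_iff_isClosed, hT, closure_union, hIfin.closure_biUnion]
    refine union_subset (hcl.trans Subset.rfl) ?_
    refine iUnion₂_subset fun y hy => ?_
    rw [closure_closure]
    exact subset_union_of_subset_right (subset_iUnion₂ (s := fun y _ => closure (Λ.dom y).carrier) y hy) _
  -- `T` is open
  have hTop : IsOpen T := by
    rw [isOpen_iff_forall_mem_open]
    rintro z hz
    rcases hz with hz | hz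
    · exact ⟨𝒮.val '' P, subset_union_left, 𝒮.isOpenMap_val _ Λ.isOpen_subl.connectedComponentIn, hz⟩
    · obtain ⟨y₀, hy₀I, hzy₀⟩ := mem_iUnion₂.1 hz
      have hsubT : closure (Λ.dom y₀).carrier ⊆ T := fun w hw => Or.inr (mem_iUnion₂.2 ⟨y₀, hy₀I, hw⟩)
      rw [closure_eq_self_union_frontier] at hzy₀
      rcases hzy₀ with hzD | hzJ
      · exact ⟨(Λ.dom y₀).carrier, subset_closure.trans hsubT, (Λ.dom y₀).isOpen, hzD⟩
      · -- a curve point: the planar tube is a neighbourhood inside `T`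
        rw [Λ.frontier_dom y₀] at hzJ
        obtain ⟨_, ⟨y, hy, rfl⟩, rfl⟩ := hzJ
        refine ⟨𝒮.val '' Λ.tube U y₀, ?_, 𝒮.isOpenMap_val _ (Λ.isOpen_tube U y₀), ⟨Λ.incl y, Λ.incl_mem_tube U hy, rfl⟩⟩
        have hneg : Λ.tubeNeg U y₀ ⊆ P := Λ.tubeNeg_subset_of_meets U hy₀I.2
        have hpos : 𝒮.val '' Λ.tubePos U y₀ ⊆ (Λ.dom y₀).carrier := Λ.val_tubePos_subset_dom U hy₀I.2 (hout y₀)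
        rintro _ ⟨x, hx, rfl⟩
        rcases Λ.tube_subset U y₀ hx with (h' | ⟨y', hy', rfl⟩) | h'
        · exact Or.inl ⟨x, hneg h', rfl⟩
        · refine hsubT (frontier_subset_closure ?_)
          rw [Λ.frontier_dom y₀]
          exact ⟨Λ.incl y', ⟨y', hy', rfl⟩, rfl⟩
        · exact hsubT (subset_closure (hpos ⟨x, h', rfl⟩))
  -- `T` is clopen, nonempty and not everything: contradiction
  rcases isClopen_iff.1 ⟨hTcl, hTop⟩ with h | h
  · have : 𝒮.val x₀ ∈ T := Or.inl ⟨x₀, mem_connectedComponentIn (Λ.lt_of_mem_core x₀ hx₀), rfl⟩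
    rw [h] at this; exact this
  · have : (0 : ℂ) ∈ T := by rw [h]; exact mem_univ _
    have := (hTann this).1
    rw [norm_zero] at this
    linarith

end LevelData

end PlaneAtlas

end Literature.Topology.FourManifolds

end


noncomputable section

namespace Literature.Topology.FourManifolds

open _root_.Set _root_.Metric _root_.OpenPartialHomeomorph _root_.Filter
open scoped _root_.Manifold _root_.Topology _root_.ContDiff
open Literature.Geometry.Manifold (AtlasOn)
open Literature.Geometry.Manifold.AtlasOn
open Literature.Probability.RandomPlanarGeometry (JordanDomain)
open Literature.Probability.RandomPlanarGeometry.JordanDomain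
open Literature.Topology.PlaneTopology

/-- Local notation for the model plane `ℝ²`. -/
local notation "𝔼₂" => EuclideanSpace ℝ (Fin 2)

/-- Local notation: the unit circle in `ℝ²` with its manifold structure. -/
local notation "𝕊¹" => (Metric.sphere (0 : EuclideanSpace ℝ (Fin (1 + 1))) 1)

namespace PlaneAtlas

/-! ### The direction point of a nonzero complex number on the unit circle of `ℝ²` -/

/-- The coordinates of `circlePoint (arg z)` are `(re z, im z) / ‖z‖`. [folklore] -/
theorem circlePoint_arg_coe {z : ℂ} (hz : z ≠ 0) :
    ((circlePoint (Complex.arg z) : 𝕊¹) : EuclideanSpace ℝ (Fin (1 + 1))) = WithLp.toLp 2 ![z.re / ‖z‖, z.im / ‖z‖] := by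
  ext i
  fin_cases i
  · exact Complex.cos_arg hz
  · exact Complex.sin_arg z

/-- `circlePoint (arg (-z) + π) = circlePoint (arg z)` for `z ≠ 0`. [folklore] -/
theorem circlePoint_arg_neg_add_pi {z : ℂ} (hz : z ≠ 0) :
    circlePoint (Complex.arg (-z) + Real.pi) = circlePoint (Complex.arg z) := by
  apply Subtype.ext
  rw [circlePoint_arg_coe hz]
  ext i
  fin_cases i
  · show Real.cos (Complex.arg (-z) + Real.pi) = z.re / ‖z‖
    rw [Real.cos_add_pi, Complex.cos_arg (neg_ne_zero.2 hz), Complex.neg_re, norm_neg]; ring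
  · show Real.sin (Complex.arg (-z) + Real.pi) = z.im / ‖z‖
    rw [Real.sin_add_pi, Complex.sin_arg, Complex.neg_im, norm_neg]; ring

/-- Real smoothness of the principal logarithm on the slit plane. [folklore] -/
theorem contDiffAt_log_real {z : ℂ} (hz : z ∈ Complex.slitPlane) : ContDiffAt ℝ ∞ Complex.log z :=
  (Complex.contDiffAt_log hz).restrict_scalars ℝ

namespace LevelData

variable {ρ η : ℝ} {𝒮 : PlaneAtlas (annulus ρ η)} (Λ : LevelData 𝒮) (U : BandUnitField 1 Λ.f Λ.a)

/-! ### The collar map of an embedded level circle -/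

/-- **Collar data**: a smooth embedding `γ` of the circle onto a component of the level.
[folklore] -/
structure Collar where
  /-- A point of the component. -/
  y : Λ.Lv
  /-- The embedded circle. -/
  γ : 𝕊¹ → 𝒮.Man
  /-- It is a smooth embedding. -/
  isSmoothEmbedding : Manifold.IsSmoothEmbedding (𝓡 1) (𝓡 (1 + 1)) ∞ γ
  /-- Its range is the component of the level through `y`. -/
  range_eq : range γ = Λ.incl '' connectedComponent y
  /-- The orientation sign of the collar (which side of the level is "inside"). -/
  σ : ℝ
  /-- The sign is `±1`. -/
  σ_eq : σ = 1 ∨ σ = -1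

/-- Every point of the level has collar data (with sign `+1`). [folklore] -/
theorem nonempty_collar (y : Λ.Lv) : ∃ Γ : Λ.Collar, Γ.y = y ∧ Γ.σ = 1 := by
  obtain ⟨γ, hγ, hr⟩ := Λ.exists_circle y
  exact ⟨⟨y, γ, hγ, hr, 1, Or.inl rfl⟩, rfl, rfl⟩

namespace Collar

variable {Λ} (Γ : Λ.Collar)

/-- The collar with the opposite orientation sign. [folklore] -/
def reverse : Λ.Collar := ⟨Γ.y, Γ.γ, Γ.isSmoothEmbedding, Γ.range_eq, -Γ.σ, by rcases Γ.σ_eq with h | h <;> simp [h]⟩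

/-- The reversed collar has the same base point. [folklore] -/
@[simp] theorem reverse_y : Γ.reverse.y = Γ.y := rfl

/-- The reversed collar has the same circle. [folklore] -/
@[simp] theorem reverse_γ : Γ.reverse.γ = Γ.γ := rfl

/-- The reversed collar has the opposite sign. [folklore] -/
@[simp] theorem reverse_σ : Γ.reverse.σ = -Γ.σ := rfl

/-- `σ² = 1`. [folklore] -/
theorem σ_mul_σ : Γ.σ * Γ.σ = 1 := by rcases Γ.σ_eq with h | h <;> simp [h]

/-- `|σ| = 1`. [folklore] -/
theorem abs_σ : |Γ.σ| = 1 := by rcases Γ.σ_eq with h | h <;> simp [h]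

/-- `σ ≠ 0`. [folklore] -/
theorem σ_ne_zero : Γ.σ ≠ 0 := by rcases Γ.σ_eq with h | h <;> simp [h]

/-- `γ` is continuous. [folklore] -/
theorem continuous_γ : Continuous Γ.γ := Γ.isSmoothEmbedding.isEmbedding.continuous

/-- `γ` is injective. [folklore] -/
theorem injective_γ : Function.Injective Γ.γ := Γ.isSmoothEmbedding.isEmbedding.injective

/-- `γ` is smooth. [folklore] -/
theorem contMDiff_γ : ContMDiff (𝓡 1) (𝓡 (1 + 1)) ∞ Γ.γ := Γ.isSmoothEmbedding.contMDiff

/-- `γ` lands on the level. [folklore] -/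
theorem apply_γ (u : 𝕊¹) : Λ.f (Γ.γ u) = Λ.a := by
  have : Γ.γ u ∈ Λ.incl '' connectedComponent Γ.y := by rw [← Γ.range_eq]; exact mem_range_self u
  obtain ⟨y', -, hy'⟩ := this
  rw [← hy']; exact y'.2

/-- **The collar map in logarithmic coordinates**: `C w = fl (γ (circlePoint (im w))) (σ κ re w)`,
with time scale `κ = U.δ` and orientation sign `σ`; smooth on all of `ℂ` and `2πi`-periodic.
[folklore] -/
def logCollar (w : ℂ) : 𝒮.Man := U.fl (Γ.γ (circlePoint w.im)) (Γ.σ * U.δ * w.re)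

/-- The collar map in logarithmic coordinates is smooth. [folklore] -/
theorem contMDiff_logCollar : ContMDiff 𝓘(ℝ, ℂ) (𝓡 (1 + 1)) ∞ (Γ.logCollar U) := by
  have h1 : ContMDiff 𝓘(ℝ, ℂ) (𝓡 1) ∞ fun w : ℂ => circlePoint w.im :=
    contMDiff_circlePoint.comp Complex.imCLM.contDiff.contMDiff  -- `DehnSurgeryTubularNbhdProofs`
  have h2 : ContMDiff 𝓘(ℝ, ℂ) 𝓘(ℝ, ℝ) ∞ fun w : ℂ => Γ.σ * U.δ * w.re :=
    (contDiff_const.mul Complex.reCLM.contDiff).contMDiff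
  exact U.contMDiff_fl.comp ((Γ.contMDiff_γ.comp h1).prodMk h2)

/-- **The collar map** on `ℂ ∖ {0}`: `c z = fl (γ (direction of z)) (σ κ log ‖z‖)`, i.e.
`logCollar (log z)`. [folklore] -/
def collarMap (z : ℂ) : 𝒮.Man := Γ.logCollar U (Complex.log z)

/-- The collar map in terms of the direction point and `log ‖z‖`. [folklore] -/
theorem collarMap_eq (z : ℂ) :
    Γ.collarMap U z = U.fl (Γ.γ (circlePoint (Complex.arg z))) (Γ.σ * U.δ * Real.log ‖z‖) := by
  rw [collarMap, logCollar, Complex.log_im, Complex.log_re]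

/-- The other branch: `c z = logCollar (log (-z) + πi)` (`z ≠ 0`). [folklore] -/
theorem collarMap_eq_neg_branch {z : ℂ} (hz : z ≠ 0) :
    Γ.collarMap U z = Γ.logCollar U (Complex.log (-z) + Real.pi * Complex.I) := by
  rw [collarMap_eq, logCollar]
  simp only [Complex.add_im, Complex.log_im, Complex.mul_im, Complex.ofReal_re, Complex.I_im, mul_one,
    Complex.ofReal_im, Complex.I_re, mul_zero, add_zero, Complex.add_re, Complex.log_re, norm_neg,
    Complex.mul_re, sub_zero]
  rw [circlePoint_arg_neg_add_pi hz]

/-- **The collar map is smooth on `ℂ ∖ {0}`** (both branches of the logarithm). [folklore] -/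
theorem contMDiffAt_collarMap {z : ℂ} (hz : z ≠ 0) : ContMDiffAt 𝓘(ℝ, ℂ) (𝓡 (1 + 1)) ∞ (Γ.collarMap U) z := by
  rcases Complex.mem_slitPlane_or_neg_mem_slitPlane hz with h | h
  · exact (Γ.contMDiff_logCollar U).contMDiffAt.comp z (contDiffAt_log_real h).contMDiffAt
  · have heq : Γ.collarMap U =ᶠ[𝓝 z] fun w => Γ.logCollar U (Complex.log (-w) + Real.pi * Complex.I) := by
      filter_upwards [isOpen_ne.mem_nhds hz] with w hw
      exact Γ.collarMap_eq_neg_branch U hw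
    refine ContMDiffAt.congr_of_eventuallyEq ?_ heq
    refine (Γ.contMDiff_logCollar U).contMDiffAt.comp z ?_
    exact (((contDiffAt_log_real h).comp z contDiff_neg.contDiffAt).add contDiffAt_const).contMDiffAt

/-- The collar map is smooth on every set avoiding `0`. [folklore] -/
theorem contMDiffOn_collarMap {s : Set ℂ} (hs : (0 : ℂ) ∉ s) : ContMDiffOn 𝓘(ℝ, ℂ) (𝓡 (1 + 1)) ∞ (Γ.collarMap U) s :=
  fun _ hz => (Γ.contMDiffAt_collarMap U (fun h => hs (h ▸ hz))).contMDiffWithinAt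

/-! ### The logarithmic annulus and the values of the collar map -/

/-- The round annulus `{e^{-1/2} < ‖z‖ < e^{1/2}}` on which the collar map is used. [folklore] -/
def roundAnn : Set ℂ := {z | Real.exp (-(1 / 2)) < ‖z‖ ∧ ‖z‖ < Real.exp (1 / 2)}

/-- The round annulus is open. [folklore] -/
theorem isOpen_roundAnn : IsOpen roundAnn :=
  (isOpen_lt continuous_const continuous_norm).inter (isOpen_lt continuous_norm continuous_const)

/-- Points of the round annulus are nonzero. [folklore] -/
theorem ne_zero_of_mem_roundAnn {z : ℂ} (hz : z ∈ roundAnn) : z ≠ 0 := by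
  intro h; rw [h] at hz; simp only [roundAnn, mem_setOf_eq, norm_zero] at hz; linarith [hz.1, Real.exp_pos (-(1/2 : ℝ))]

/-- `0` is not in the round annulus. [folklore] -/
theorem zero_notMem_roundAnn : (0 : ℂ) ∉ roundAnn := fun h => ne_zero_of_mem_roundAnn h rfl

/-- In the round annulus `|log ‖z‖| < 1/2`. [folklore] -/
theorem abs_log_norm_lt {z : ℂ} (hz : z ∈ roundAnn) : |Real.log ‖z‖| < 1 / 2 := by
  have hz0 : 0 < ‖z‖ := (Real.exp_pos _).trans hz.1
  rw [abs_lt]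
  constructor
  · have := Real.log_lt_log (Real.exp_pos _) hz.1; rwa [Real.log_exp] at this
  · have := Real.log_lt_log hz0 hz.2; rwa [Real.log_exp] at this

/-- The (signed) time `σ κ log ‖z‖` has absolute value `< δ/2` on the round annulus. [folklore] -/
theorem time_mem_Ioo_half {z : ℂ} (hz : z ∈ roundAnn) : Γ.σ * U.δ * Real.log ‖z‖ ∈ Ioo (-(U.δ / 2)) (U.δ / 2) := by
  have h := abs_log_norm_lt hz
  have hδ := U.δ_pos
  have key : |Γ.σ * U.δ * Real.log ‖z‖| < U.δ / 2 := by
    rw [abs_mul, abs_mul, Γ.abs_σ, one_mul, abs_of_pos hδ]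
    nlinarith
  rw [abs_lt] at key
  exact key

/-- The (signed) time lies in `(-δ, δ)` on the round annulus. [folklore] -/
theorem time_mem_Ioo {z : ℂ} (hz : z ∈ roundAnn) : Γ.σ * U.δ * Real.log ‖z‖ ∈ Ioo (-U.δ) U.δ := by
  have h := Γ.time_mem_Ioo_half U hz
  exact ⟨by linarith [h.1, U.δ_pos], by linarith [h.2, U.δ_pos]⟩

/-- **Values of the collar map**: `f (c z) = a + σ κ log ‖z‖` on the round annulus. [folklore] -/
theorem apply_collarMap {z : ℂ} (hz : z ∈ roundAnn) : Λ.f (Γ.collarMap U z) = Λ.a + Γ.σ * U.δ * Real.log ‖z‖ := by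
  rw [collarMap_eq]; exact U.apply_fl_of_apply_eq (Γ.apply_γ _) (Γ.time_mem_Ioo U hz)

/-- The drop of the collar map is the circle point. [folklore] -/
theorem drop_collarMap {z : ℂ} (hz : z ∈ roundAnn) : U.drop (Γ.collarMap U z) = Γ.γ (circlePoint (Complex.arg z)) := by
  rw [collarMap_eq]; exact U.drop_fl_of_apply_eq (Γ.apply_γ _) (Γ.time_mem_Ioo U hz)

/-- On the unit circle the collar map is the embedded circle. [folklore] -/
theorem collarMap_of_norm_eq_one {z : ℂ} (hz : ‖z‖ = 1) : Γ.collarMap U z = Γ.γ (circlePoint (Complex.arg z)) := by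
  rw [collarMap_eq, hz, Real.log_one, mul_zero, U.fl_zero]

/-- **The collar map is injective on the round annulus.** [folklore] -/
theorem injOn_collarMap : InjOn (Γ.collarMap U) roundAnn := by
  intro z hz z' hz' heq
  have hz0 := ne_zero_of_mem_roundAnn hz
  have hz0' := ne_zero_of_mem_roundAnn hz'
  rw [collarMap_eq, collarMap_eq] at heq
  have key := U.fl_injOn (x₁ := (Γ.γ (circlePoint (Complex.arg z)), Γ.σ * U.δ * Real.log ‖z‖))
    (x₂ := (Γ.γ (circlePoint (Complex.arg z')), Γ.σ * U.δ * Real.log ‖z'‖))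
    ⟨show Λ.f _ = Λ.a from Γ.apply_γ _, Γ.time_mem_Ioo U hz⟩ ⟨show Λ.f _ = Λ.a from Γ.apply_γ _, Γ.time_mem_Ioo U hz'⟩ heq
  simp only [Prod.mk.injEq] at key
  obtain ⟨h1, h2⟩ := key
  have hn : ‖z‖ = ‖z'‖ := by
    have h2' : Γ.σ * U.δ * Real.log ‖z‖ = Γ.σ * U.δ * Real.log ‖z'‖ := h2
    have := mul_left_cancel₀ (mul_ne_zero Γ.σ_ne_zero U.δ_pos.ne') h2'
    exact Real.log_injOn_pos ((Real.exp_pos _).trans hz.1) ((Real.exp_pos _).trans hz'.1) this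
  have harg : Complex.arg z = Complex.arg z' := by
    obtain ⟨k, hk⟩ := circlePoint_eq_circlePoint_iff.1 (Γ.injective_γ h1)
    have hb := Complex.neg_pi_lt_arg z
    have hb' := Complex.arg_le_pi z
    have hc := Complex.neg_pi_lt_arg z'
    have hc' := Complex.arg_le_pi z'
    have habs : |(k : ℝ)| < 1 := by
      have : |Complex.arg z - Complex.arg z'| < 2 * Real.pi := by rw [abs_lt]; constructor <;> linarith
      rw [hk, abs_mul, abs_of_pos Real.two_pi_pos] at this
      by_contra hle; push Not at hle; nlinarith [Real.pi_pos]
    have hk0 : k = 0 := by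
      have : |k| < 1 := by exact_mod_cast habs
      rw [abs_lt] at this; omega
    rw [hk0, Int.cast_zero, mul_zero, sub_eq_zero] at hk
    exact hk
  exact Complex.ext_norm_arg hn harg

end Collar

end LevelData

end PlaneAtlas

end Literature.Topology.FourManifolds

end


noncomputable section

namespace Literature.Topology.FourManifolds

open _root_.Set _root_.Metric _root_.OpenPartialHomeomorph _root_.Filter
open scoped _root_.Manifold _root_.Topology _root_.ContDiff
open Literature.Geometry.Manifold (AtlasOn)
open Literature.Geometry.Manifold.AtlasOn
open Literature.Probability.RandomPlanarGeometry (JordanDomain)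
open Literature.Probability.RandomPlanarGeometry.JordanDomain
open Literature.Topology.PlaneTopology

/-- Local notation for the model plane `ℝ²`. -/
local notation "𝔼₂" => EuclideanSpace ℝ (Fin 2)

/-- Local notation: the unit circle in `ℝ²` with its manifold structure. -/
local notation "𝕊¹" => (Metric.sphere (0 : EuclideanSpace ℝ (Fin (1 + 1))) 1)

namespace PlaneAtlas

/-! ### The unit complex number of a point of the circle of `ℝ²` -/

/-- The complex number with real and imaginary parts the two coordinates of a vector of `ℝ²`
(a continuous real-linear map). [folklore] -/
def toC : EuclideanSpace ℝ (Fin (1 + 1)) →L[ℝ] ℂ :=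
  Complex.equivRealProdCLM.symm.toContinuousLinearMap.comp
    ((EuclideanSpace.proj (0 : Fin (1 + 1))).prod (EuclideanSpace.proj (1 : Fin (1 + 1))))

/-- `toC v = v 0 + v 1 i`. [folklore] -/
theorem toC_apply (v : EuclideanSpace ℝ (Fin (1 + 1))) : toC v = ⟨v 0, v 1⟩ := rfl

/-- The unit complex number of a point of the unit circle of `ℝ²`. [folklore] -/
def dirC (u : 𝕊¹) : ℂ := toC (u : EuclideanSpace ℝ (Fin (1 + 1)))

/-- Real part of `dirC`. [folklore] -/
@[simp] theorem dirC_re (u : 𝕊¹) : (dirC u).re = (u : EuclideanSpace ℝ (Fin (1 + 1))) 0 := rfl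

/-- Imaginary part of `dirC`. [folklore] -/
@[simp] theorem dirC_im (u : 𝕊¹) : (dirC u).im = (u : EuclideanSpace ℝ (Fin (1 + 1))) 1 := rfl

/-- `dirC u` is a unit complex number. [folklore] -/
theorem norm_dirC (u : 𝕊¹) : ‖dirC u‖ = 1 := by
  have hu := u.2
  rw [mem_sphere_zero_iff_norm, EuclideanSpace.norm_eq, Fin.sum_univ_two] at hu
  rw [Complex.norm_eq_sqrt_sq_add_sq, dirC_re, dirC_im]
  simpa using hu

/-- `dirC u ≠ 0`. [folklore] -/
theorem dirC_ne_zero (u : 𝕊¹) : dirC u ≠ 0 := by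
  rw [← norm_ne_zero_iff, norm_dirC]; exact one_ne_zero

/-- `dirC` is smooth on the circle. [folklore] -/
theorem contMDiff_dirC : ContMDiff (𝓡 1) 𝓘(ℝ, ℂ) ∞ dirC := by
  haveI := Fact.mk (@finrank_euclideanSpace_fin ℝ _ (1 + 1))
  exact toC.contDiff.contMDiff.comp (contMDiff_coe_sphere (E := EuclideanSpace ℝ (Fin (1 + 1))) (n := 1))

/-- `dirC` of the direction point of `z ≠ 0` is `z / ‖z‖`. [folklore] -/
theorem dirC_circlePoint_arg {z : ℂ} (hz : z ≠ 0) : dirC (circlePoint (Complex.arg z)) = (‖z‖ : ℂ)⁻¹ * z := by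
  apply Complex.ext
  · rw [dirC_re, circlePoint_arg_coe hz, ← Complex.ofReal_inv, Complex.re_ofReal_mul]
    simp [div_eq_inv_mul]
  · rw [dirC_im, circlePoint_arg_coe hz, ← Complex.ofReal_inv, Complex.im_ofReal_mul]
    simp [div_eq_inv_mul]

/-- The direction point of `dirC u` is `u`. [folklore] -/
theorem circlePoint_arg_dirC (u : 𝕊¹) : circlePoint (Complex.arg (dirC u)) = u := by
  apply Subtype.ext
  rw [circlePoint_arg_coe (dirC_ne_zero u), norm_dirC]
  ext i
  fin_cases i <;> simp

/-- The direction point of a positive real multiple. [folklore] -/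
theorem circlePoint_arg_real_mul {r : ℝ} (hr : 0 < r) (w : ℂ) :
    circlePoint (Complex.arg ((r : ℂ) * w)) = circlePoint (Complex.arg w) := by
  rw [Complex.arg_real_mul w hr]

namespace LevelData

variable {ρ η : ℝ} {𝒮 : PlaneAtlas (annulus ρ η)} {Λ : LevelData 𝒮} (Γ : Λ.Collar) (U : BandUnitField 1 Λ.f Λ.a)

namespace Collar

/-! ### The inverse of the collar map and its tube -/

/-- **The inverse collar map**: `p ↦ e^{σ (f p - a)/κ} · dirC (γ⁻¹ (drop p))`. [folklore] -/
def collarInv (p : 𝒮.Man) : ℂ :=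
  Real.exp (Γ.σ * (Λ.f p - Λ.a) / U.δ) • dirC (Function.invFun Γ.γ (U.drop p))

/-- The inverse collar map as a product. [folklore] -/
theorem collarInv_eq (p : 𝒮.Man) :
    Γ.collarInv U p = (Real.exp (Γ.σ * (Λ.f p - Λ.a) / U.δ) : ℂ) * dirC (Function.invFun Γ.γ (U.drop p)) :=
  Complex.real_smul

/-- **The tube of the collar**: the flow-out of the component for times in `(-δ/2, δ/2)`.
[folklore] -/
def tubeC : Set 𝒮.Man := Λ.Φ U '' (connectedComponent Γ.y ×ˢ Ioo (-(U.δ / 2)) (U.δ / 2))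

/-- The tube of the collar is open. [folklore] -/
theorem isOpen_tubeC : IsOpen (Γ.tubeC U) :=
  (Λ.Φ U).isOpen_image_of_subset_source (isOpen_connectedComponent.prod isOpen_Ioo)
    (by rw [BandUnitField.collarChart_source]
        exact prod_mono (subset_univ _) (Ioo_subset_Ioo (by linarith [U.δ_pos]) (by linarith [U.δ_pos])))

/-- The tube of the collar lies in the full tube of the component. [folklore] -/
theorem tubeC_subset_tube : Γ.tubeC U ⊆ Λ.tube U Γ.y :=
  image_mono (prod_mono Subset.rfl (Ioo_subset_Ioo (by linarith [U.δ_pos]) (by linarith [U.δ_pos])))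

/-- `γ⁻¹ ∘ γ = id`. [folklore] -/
theorem invFun_γ (u : 𝕊¹) : Function.invFun Γ.γ (Γ.γ u) = u := Function.leftInverse_invFun Γ.injective_γ u

/-- **`collarInv ∘ collarMap = id` on the round annulus.** [folklore] -/
theorem collarInv_collarMap {z : ℂ} (hz : z ∈ roundAnn) : Γ.collarInv U (Γ.collarMap U z) = z := by
  have hz0 := ne_zero_of_mem_roundAnn hz
  have hn : 0 < ‖z‖ := norm_pos_iff.2 hz0
  rw [collarInv_eq, Γ.apply_collarMap U hz, Γ.drop_collarMap U hz, invFun_γ, dirC_circlePoint_arg hz0,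
    add_sub_cancel_left, show Γ.σ * (Γ.σ * U.δ * Real.log ‖z‖) / U.δ = Real.log ‖z‖ by
      rw [show Γ.σ * (Γ.σ * U.δ * Real.log ‖z‖) = (Γ.σ * Γ.σ) * (U.δ * Real.log ‖z‖) by ring, Γ.σ_mul_σ, one_mul,
        mul_div_cancel_left₀ _ U.δ_pos.ne'], Real.exp_log hn, ← mul_assoc,
    mul_inv_cancel₀ (by exact_mod_cast hn.ne'), one_mul]

/-- The collar map lands in the tube of the collar. [folklore] -/
theorem collarMap_mem_tubeC {z : ℂ} (hz : z ∈ roundAnn) : Γ.collarMap U z ∈ Γ.tubeC U := by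
  have hmem : Γ.γ (circlePoint (Complex.arg z)) ∈ Λ.incl '' connectedComponent Γ.y := by
    rw [← Γ.range_eq]; exact mem_range_self _
  obtain ⟨y', hy', hyγ⟩ := hmem
  refine ⟨(y', Γ.σ * U.δ * Real.log ‖z‖), ⟨hy', Γ.time_mem_Ioo_half U hz⟩, ?_⟩
  rw [BandUnitField.collarChart_apply, Γ.collarMap_eq U]
  exact congrArg (fun q => U.fl q (Γ.σ * U.δ * Real.log ‖z‖)) hyγ

/-- Points of the tube of the collar: `p = fl (incl y') t`, `y'` in the component, `|t| < δ/2`,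
`f p = a + t`, `drop p = incl y'`. [folklore] -/
theorem exists_of_mem_tubeC {p : 𝒮.Man} (hp : p ∈ Γ.tubeC U) :
    ∃ (y' : Λ.Lv) (t : ℝ), y' ∈ connectedComponent Γ.y ∧ t ∈ Ioo (-(U.δ / 2)) (U.δ / 2) ∧ p = U.fl (Λ.incl y') t ∧
      Λ.f p = Λ.a + t ∧ U.drop p = Λ.incl y' := by
  obtain ⟨⟨y', t⟩, ⟨hy', ht⟩, rfl⟩ := hp
  have ht' : t ∈ Ioo (-U.δ) U.δ := ⟨by linarith [ht.1, U.δ_pos], by linarith [ht.2, U.δ_pos]⟩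
  exact ⟨y', t, hy', ht, rfl, U.apply_fl_of_apply_eq y'.2 ht', U.drop_fl_of_apply_eq y'.2 ht'⟩

/-- The drop of a point of the tube lies on the embedded circle. [folklore] -/
theorem drop_mem_range {p : 𝒮.Man} (hp : p ∈ Γ.tubeC U) : U.drop p ∈ range Γ.γ := by
  obtain ⟨y', t, hy', -, -, -, hdrop⟩ := Γ.exists_of_mem_tubeC U hp
  rw [hdrop, Γ.range_eq]; exact ⟨y', hy', rfl⟩

/-- **`collarMap ∘ collarInv = id` on the tube.** [folklore] -/
theorem collarMap_collarInv {p : 𝒮.Man} (hp : p ∈ Γ.tubeC U) : Γ.collarMap U (Γ.collarInv U p) = p := by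
  obtain ⟨y', t, hy', ht, hpeq, hfp, hdrop⟩ := Γ.exists_of_mem_tubeC U hp
  have hrange : Λ.incl y' ∈ range Γ.γ := by rw [Γ.range_eq]; exact ⟨y', hy', rfl⟩
  set u := Function.invFun Γ.γ (Λ.incl y') with hu
  have hγu : Γ.γ u = Λ.incl y' := Function.invFun_eq hrange
  have hexp : 0 < Real.exp (Γ.σ * (Λ.f p - Λ.a) / U.δ) := Real.exp_pos _
  rw [Γ.collarMap_eq U, collarInv_eq, hdrop, ← hu, circlePoint_arg_real_mul hexp, circlePoint_arg_dirC, hγu,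
    norm_mul, Complex.norm_real, Real.norm_eq_abs, abs_of_pos hexp, norm_dirC, mul_one, Real.log_exp, hfp,
    add_sub_cancel_left, show Γ.σ * U.δ * (Γ.σ * t / U.δ) = t by
      rw [show Γ.σ * U.δ * (Γ.σ * t / U.δ) = (Γ.σ * Γ.σ) * t * (U.δ / U.δ) by ring, Γ.σ_mul_σ, one_mul,
        div_self U.δ_pos.ne', mul_one], hpeq]

/-- `collarInv` maps the tube into the round annulus. [folklore] -/
theorem collarInv_mem_roundAnn {p : 𝒮.Man} (hp : p ∈ Γ.tubeC U) : Γ.collarInv U p ∈ roundAnn := by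
  obtain ⟨y', t, -, ht, -, hfp, -⟩ := Γ.exists_of_mem_tubeC U hp
  have hexp : 0 < Real.exp (Γ.σ * (Λ.f p - Λ.a) / U.δ) := Real.exp_pos _
  have hn : ‖Γ.collarInv U p‖ = Real.exp (Γ.σ * t / U.δ) := by
    rw [collarInv_eq, norm_mul, Complex.norm_real, Real.norm_eq_abs, abs_of_pos hexp, norm_dirC, mul_one, hfp,
      add_sub_cancel_left]
  have hδ := U.δ_pos
  have ht' : -(1 / 2) < Γ.σ * t / U.δ ∧ Γ.σ * t / U.δ < 1 / 2 := by
    have key : |Γ.σ * t / U.δ| < 1 / 2 := by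
      rw [abs_div, abs_mul, Γ.abs_σ, one_mul, abs_of_pos hδ, div_lt_iff₀ hδ, abs_lt]
      constructor <;> linarith [ht.1, ht.2]
    exact abs_lt.1 key
  refine ⟨?_, ?_⟩ <;> rw [hn]
  · exact Real.exp_lt_exp.2 ht'.1
  · exact Real.exp_lt_exp.2 ht'.2

/-- **The collar map is a bijection of the round annulus onto the tube**, with inverse
`collarInv`. [folklore] -/
theorem bijOn_collarMap : BijOn (Γ.collarMap U) roundAnn (Γ.tubeC U) :=
  ⟨fun _ hz => Γ.collarMap_mem_tubeC U hz, Γ.injOn_collarMap U,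
    fun p hp => ⟨Γ.collarInv U p, Γ.collarInv_mem_roundAnn U hp, Γ.collarMap_collarInv U hp⟩⟩

/-- The image of the round annulus is the tube. [folklore] -/
theorem image_collarMap : Γ.collarMap U '' roundAnn = Γ.tubeC U := (Γ.bijOn_collarMap U).image_eq

/-- **The inverse collar map is smooth on the tube** (the inverse of the smooth embedding `γ`
is smooth on its range, `contMDiffOn_invFun_range`). [folklore] -/
theorem contMDiffOn_collarInv : ContMDiffOn (𝓡 (1 + 1)) 𝓘(ℝ, ℂ) ∞ (Γ.collarInv U) (Γ.tubeC U) := by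
  have h1 : ContMDiff (𝓡 (1 + 1)) 𝓘(ℝ, ℝ) ∞ fun p : 𝒮.Man => Real.exp (Γ.σ * (Λ.f p - Λ.a) / U.δ) :=
    Real.contDiff_exp.contMDiff.comp ((contMDiff_const.mul (Λ.contMDiff.sub contMDiff_const)).div_const _)
  have h2 : ContMDiffOn (𝓡 (1 + 1)) (𝓡 1) ∞ (Function.invFun Γ.γ ∘ U.drop) (Γ.tubeC U) :=
    (Literature.Geometry.Manifold.contMDiffOn_invFun_range Γ.isSmoothEmbedding).comp U.contMDiff_drop.contMDiffOn
      fun p hp => Γ.drop_mem_range U hp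
  exact h1.contMDiffOn.smul (contMDiff_dirC.comp_contMDiffOn h2)

/-- The inverse collar map is continuous on the tube. [folklore] -/
theorem continuousOn_collarInv : ContinuousOn (Γ.collarInv U) (Γ.tubeC U) := (Γ.contMDiffOn_collarInv U).continuousOn

/-- The collar map is continuous on the round annulus. [folklore] -/
theorem continuousOn_collarMap : ContinuousOn (Γ.collarMap U) roundAnn :=
  (Γ.contMDiffOn_collarMap U zero_notMem_roundAnn).continuousOn

/-! ### Reading the collar in the charts of the atlas -/

/-- **The collar map is `𝒮`-smooth**: read in any chart of `𝒮` it is `C^∞` on the round annulus.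
[folklore] -/
theorem contDiffOn_chart_collarMap {e : OpenPartialHomeomorph ℂ 𝔼₂} (he : e ∈ 𝒮.charts) :
    ContDiffOn ℝ ∞ (fun z => e (𝒮.val (Γ.collarMap U z))) (roundAnn ∩ Γ.collarMap U ⁻¹' (𝒮.val ⁻¹' e.source)) :=
  contDiffOn_chart_comp (Γ.contMDiffOn_collarMap U zero_notMem_roundAnn) he

/-- **The inverse collar map is `𝒮`-smooth**: precomposed with the inverse of any chart of `𝒮` it
is `C^∞` on the chart image of the tube. [folklore] -/
theorem contDiffOn_collarInv_chart_symm {e : OpenPartialHomeomorph ℂ 𝔼₂} (he : e ∈ 𝒮.charts) (hne : Nonempty 𝒮.opens) :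
    ContDiffOn ℝ ∞ (Γ.collarInv U ∘ (𝒮.chart e hne).symm) (𝒮.chart e hne '' (Γ.tubeC U ∩ (𝒮.chart e hne).source)) :=
  contDiffOn_comp_chart_symm (Γ.contMDiffOn_collarInv U) he hne

end Collar

end LevelData

end PlaneAtlas

end Literature.Topology.FourManifolds

end


noncomputable section

namespace Literature.Topology.FourManifolds

open _root_.Set _root_.Metric _root_.OpenPartialHomeomorph _root_.Filter
open scoped _root_.Manifold _root_.Topology _root_.ContDiff
open Literature.Geometry.Manifold (AtlasOn)
open Literature.Geometry.Manifold.AtlasOn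
open Literature.Probability.RandomPlanarGeometry (JordanDomain)
open Literature.Probability.RandomPlanarGeometry.JordanDomain
open Literature.Topology.PlaneTopology
open Literature.Topology.PlaneTopology.CircleTwist (turn norm_turn exists_turn_eq turn_eq_turn_iff)

/-- Local notation for the model plane `ℝ²`. -/
local notation "𝔼₂" => EuclideanSpace ℝ (Fin 2)

/-- Local notation: the unit circle in `ℝ²` with its manifold structure. -/
local notation "𝕊¹" => (Metric.sphere (0 : EuclideanSpace ℝ (Fin (1 + 1))) 1)

namespace PlaneAtlas

namespace LevelData

variable {ρ η : ℝ} {𝒮 : PlaneAtlas (annulus ρ η)} {Λ : LevelData 𝒮} (Γ : Λ.Collar) (U : BandUnitField 1 Λ.f Λ.a)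

namespace Collar

/-! ### The planar collar -/

/-- **The planar collar map** `z ↦ val (collarMap z)`: a continuous injection of the round
annulus into the plane annulus. [folklore] -/
def cP (z : ℂ) : ℂ := 𝒮.val (Γ.collarMap U z)

/-- The planar collar map is continuous on the round annulus. [folklore] -/
theorem continuousOn_cP : ContinuousOn (Γ.cP U) roundAnn := 𝒮.continuous_val.comp_continuousOn (Γ.continuousOn_collarMap U)

/-- The planar collar map is injective on the round annulus. [folklore] -/
theorem injOn_cP : InjOn (Γ.cP U) roundAnn := fun _ hz _ hz' h => Γ.injOn_collarMap U hz hz' (𝒮.val_injective h)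

/-- The planar collar map takes values in the plane annulus. [folklore] -/
theorem cP_mem_annulus (z : ℂ) : Γ.cP U z ∈ annulus ρ η := 𝒮.val_mem _

/-- **Images of radial shells are open**: for an open set of radii `I`, the planar collar image of
`{z ∈ roundAnn | ‖z‖ ∈ I}` is `val '' {p ∈ tube | ‖collarInv p‖ ∈ I}`, an open set. [folklore] -/
theorem image_cP_eq (I : Set ℝ) : Γ.cP U '' {z | z ∈ roundAnn ∧ ‖z‖ ∈ I} =
    𝒮.val '' {p | p ∈ Γ.tubeC U ∧ ‖Γ.collarInv U p‖ ∈ I} := by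
  ext w
  constructor
  · rintro ⟨z, ⟨hz, hzI⟩, rfl⟩
    exact ⟨Γ.collarMap U z, ⟨Γ.collarMap_mem_tubeC U hz, by rwa [Γ.collarInv_collarMap U hz]⟩, rfl⟩
  · rintro ⟨p, ⟨hp, hpI⟩, rfl⟩
    exact ⟨Γ.collarInv U p, ⟨Γ.collarInv_mem_roundAnn U hp, hpI⟩, by rw [cP, Γ.collarMap_collarInv U hp]⟩

/-- Images of open radial shells are open. [folklore] -/
theorem isOpen_image_cP {I : Set ℝ} (hI : IsOpen I) : IsOpen (Γ.cP U '' {z | z ∈ roundAnn ∧ ‖z‖ ∈ I}) := by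
  rw [image_cP_eq]
  refine 𝒮.isOpenMap_val _ ?_
  exact (Γ.continuousOn_collarInv U).norm.isOpen_inter_preimage (Γ.isOpen_tubeC U) hI

/-- The full planar collar image is open. [folklore] -/
theorem isOpen_image_cP_roundAnn : IsOpen (Γ.cP U '' roundAnn) := by
  have : roundAnn = {z | z ∈ roundAnn ∧ ‖z‖ ∈ (univ : Set ℝ)} := by ext; simp
  rw [this]; exact Γ.isOpen_image_cP U isOpen_univ

/-! ### The curves of the collar -/

/-- The curve of radius `r` of the collar: the planar image of the circle `‖z‖ = r`. [folklore] -/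
def J (r : ℝ) : Set ℂ := Γ.cP U '' sphere 0 r

/-- Radii of the round annulus. [folklore] -/
def IsRadius (r : ℝ) : Prop := Real.exp (-(1 / 2)) < r ∧ r < Real.exp (1 / 2)

/-- `1` is a radius of the round annulus. [folklore] -/
theorem isRadius_one : IsRadius 1 := ⟨by exact Real.exp_lt_one_iff.2 (by norm_num),
  Real.one_lt_exp_iff.2 (by norm_num)⟩

/-- The circle of a radius lies in the round annulus. [folklore] -/
theorem sphere_subset_roundAnn {r : ℝ} (hr : IsRadius r) : sphere (0 : ℂ) r ⊆ roundAnn := fun z hz => by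
  rw [mem_sphere_zero_iff_norm] at hz; exact ⟨hz ▸ hr.1, hz ▸ hr.2⟩

/-- A radius is positive. [folklore] -/
theorem IsRadius.pos {r : ℝ} (hr : IsRadius r) : 0 < r := (Real.exp_pos _).trans hr.1

/-- **The curves of the collar are Jordan curves.** [folklore] -/
theorem nonempty_homeomorph_J {r : ℝ} (hr : IsRadius r) : Nonempty (AddCircle (1 : ℝ) ≃ₜ Γ.J U r) := by
  set ℓ : ℝ → ℂ := fun t => Γ.cP U ((r : ℂ) * turn t) with hℓ
  have hmem : ∀ t, (r : ℂ) * turn t ∈ sphere (0 : ℂ) r := fun t => by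
    rw [mem_sphere_zero_iff_norm, norm_mul, Complex.norm_real, Real.norm_eq_abs, abs_of_pos hr.pos, norm_turn, mul_one]
  have hcont : Continuous fun t : ℝ => (r : ℂ) * turn t :=
    continuous_const.mul (by unfold Literature.Topology.PlaneTopology.CircleTwist.turn; fun_prop)
  have hℓc : Continuous ℓ := by
    refine (Γ.continuousOn_cP U).comp_continuous hcont fun t => sphere_subset_roundAnn hr (hmem t)
  have hℓp : Function.Periodic ℓ 1 := fun t => by
    simp only [hℓ]
    rw [show (t + 1 : ℝ) = t + ((1 : ℤ) : ℝ) by push_cast; ring,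
      Literature.Topology.PlaneTopology.CircleTwist.turn_add_intCast]
  have hℓi : InjOn ℓ (Ico 0 1) := by
    intro s hs t ht hst
    have h1 := Γ.injOn_cP U (sphere_subset_roundAnn hr (hmem s)) (sphere_subset_roundAnn hr (hmem t)) hst
    have h2 : turn s = turn t := mul_left_cancel₀ (by exact_mod_cast hr.pos.ne') h1
    obtain ⟨n, hn⟩ := turn_eq_turn_iff.1 h2
    have : (n : ℝ) = s - t := by linarith
    have habs : |(n : ℝ)| < 1 := by rw [this, abs_lt]; constructor <;> linarith [hs.1, hs.2, ht.1, ht.2]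
    have hn0 : n = 0 := by
      have h4 : |n| < 1 := by exact_mod_cast habs
      rw [abs_lt] at h4; omega
    rw [hn0, Int.cast_zero] at this; linarith
  have hrange : range ℓ = Γ.J U r := by
    ext w; constructor
    · rintro ⟨t, rfl⟩; exact ⟨_, hmem t, rfl⟩
    · rintro ⟨z, hz, rfl⟩
      obtain ⟨θ, -, hθ⟩ := exists_eq_polar_of_norm_eq hr.pos (mem_sphere_zero_iff_norm.1 hz) 0
      exact ⟨θ, by simp only [hℓ]; rw [← hθ]⟩
  obtain ⟨e, -⟩ := exists_homeomorph_addCircle_forall_eq hℓc hℓp hℓi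
  rw [hrange] at e
  exact ⟨e⟩

/-- **The inner domain of a curve of the collar.** [folklore] -/
def domR {r : ℝ} (hr : IsRadius r) : JordanDomain := (exists_jordanDomain_frontier_eq (Γ.nonempty_homeomorph_J U hr)).choose

/-- Its frontier is the curve. [folklore] -/
theorem frontier_domR {r : ℝ} (hr : IsRadius r) : frontier (Γ.domR U hr).carrier = Γ.J U r :=
  (exists_jordanDomain_frontier_eq (Γ.nonempty_homeomorph_J U hr)).choose_spec

/-- The unit curve of the collar is the curve of the level component. [folklore] -/
theorem J_one : Γ.J U 1 = Λ.curve Γ.y := by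
  ext w
  constructor
  · rintro ⟨z, hz, rfl⟩
    rw [cP, Γ.collarMap_of_norm_eq_one U (mem_sphere_zero_iff_norm.1 hz)]
    have : Γ.γ (circlePoint (Complex.arg z)) ∈ Λ.incl '' connectedComponent Γ.y := by
      rw [← Γ.range_eq]; exact mem_range_self _
    exact ⟨_, this, rfl⟩
  · rintro ⟨x, hx, rfl⟩
    rw [← Γ.range_eq] at hx
    obtain ⟨u, rfl⟩ := hx
    refine ⟨dirC u, mem_sphere_zero_iff_norm.2 (norm_dirC u), ?_⟩
    rw [cP, Γ.collarMap_of_norm_eq_one U (norm_dirC u), circlePoint_arg_dirC]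

/-- The inner domain of the unit curve is the inner domain of the level component. [folklore] -/
theorem domR_one_carrier : (Γ.domR U isRadius_one).carrier = (Λ.dom Γ.y).carrier :=
  (Λ.dom Γ.y).carrier_eq_of_frontier_eq' (Γ.domR U isRadius_one).isOpen (Γ.domR U isRadius_one).isBounded
    (Γ.domR U isRadius_one).isConnected (by rw [frontier_domR, Λ.frontier_dom, J_one])

/-! ### The two sides of the unit curve -/

/-- The inner half-collar `cP {e^{-1/2} < ‖z‖ < 1}`. [folklore] -/
def Bin : Set ℂ := Γ.cP U '' {z | z ∈ roundAnn ∧ ‖z‖ ∈ Iio (1 : ℝ)}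

/-- The outer half-collar `cP {1 < ‖z‖ < e^{1/2}}`. [folklore] -/
def Bout : Set ℂ := Γ.cP U '' {z | z ∈ roundAnn ∧ ‖z‖ ∈ Ioi (1 : ℝ)}

/-- The inner half of the round annulus is a plane annulus, hence connected. [folklore] -/
theorem isConnected_inner_half : IsConnected {z : ℂ | z ∈ roundAnn ∧ ‖z‖ ∈ Iio (1 : ℝ)} := by
  have h1 : Real.exp (-(1 / 2)) < 1 := by exact Real.exp_lt_one_iff.2 (by norm_num)
  have : {z : ℂ | z ∈ roundAnn ∧ ‖z‖ ∈ Iio (1 : ℝ)} =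
      annulus ((1 + Real.exp (-(1 / 2))) / 2) ((1 - Real.exp (-(1 / 2))) / 2) := by
    ext z
    simp only [mem_setOf_eq, roundAnn, mem_Iio, mem_annulus]
    constructor
    · rintro ⟨⟨ha, -⟩, hb⟩; constructor <;> linarith
    · rintro ⟨ha, hb⟩
      refine ⟨⟨by linarith, ?_⟩, by linarith⟩
      have : (1 : ℝ) < Real.exp (1 / 2) := Real.one_lt_exp_iff.2 (by norm_num)
      linarith
  rw [this]
  exact isConnected_annulus (by have := Real.exp_pos (-(1/2 : ℝ)); linarith) (by linarith)

/-- The outer half of the round annulus is a plane annulus, hence connected. [folklore] -/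
theorem isConnected_outer_half : IsConnected {z : ℂ | z ∈ roundAnn ∧ ‖z‖ ∈ Ioi (1 : ℝ)} := by
  have h1 : (1 : ℝ) < Real.exp (1 / 2) := Real.one_lt_exp_iff.2 (by norm_num)
  have : {z : ℂ | z ∈ roundAnn ∧ ‖z‖ ∈ Ioi (1 : ℝ)} =
      annulus ((Real.exp (1 / 2) + 1) / 2) ((Real.exp (1 / 2) - 1) / 2) := by
    ext z
    simp only [mem_setOf_eq, roundAnn, mem_Ioi, mem_annulus]
    constructor
    · rintro ⟨⟨-, hb⟩, ha⟩; constructor <;> linarith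
    · rintro ⟨ha, hb⟩
      refine ⟨⟨?_, by linarith⟩, by linarith⟩
      have : Real.exp (-(1 / 2)) < 1 := by exact Real.exp_lt_one_iff.2 (by norm_num)
      linarith
  rw [this]
  exact isConnected_annulus (by linarith) (by linarith)

/-- The inner half-collar is connected. [folklore] -/
theorem isConnected_Bin : IsConnected (Γ.Bin U) :=
  isConnected_inner_half.image _ ((Γ.continuousOn_cP U).mono fun _ hz => hz.1)

/-- The outer half-collar is connected. [folklore] -/
theorem isConnected_Bout : IsConnected (Γ.Bout U) :=
  isConnected_outer_half.image _ ((Γ.continuousOn_cP U).mono fun _ hz => hz.1)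

/-- The inner half-collar misses the unit curve. [folklore] -/
theorem disjoint_Bin_J : Disjoint (Γ.Bin U) (Γ.J U 1) := by
  refine Set.disjoint_left.2 ?_
  rintro _ ⟨z, ⟨hz, hz1⟩, rfl⟩ ⟨z', hz', heq⟩
  have := Γ.injOn_cP U (sphere_subset_roundAnn isRadius_one hz') hz heq
  rw [mem_sphere_zero_iff_norm] at hz'
  rw [← this, hz'] at hz1
  exact lt_irrefl _ (mem_Iio.1 hz1)

/-- The outer half-collar misses the unit curve. [folklore] -/
theorem disjoint_Bout_J : Disjoint (Γ.Bout U) (Γ.J U 1) := by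
  refine Set.disjoint_left.2 ?_
  rintro _ ⟨z, ⟨hz, hz1⟩, rfl⟩ ⟨z', hz', heq⟩
  have := Γ.injOn_cP U (sphere_subset_roundAnn isRadius_one hz') hz heq
  rw [mem_sphere_zero_iff_norm] at hz'
  rw [← this, hz'] at hz1
  exact lt_irrefl _ (mem_Ioi.1 hz1)

/-- The planar collar is the inner half, the unit curve and the outer half. [folklore] -/
theorem image_cP_roundAnn_subset : Γ.cP U '' roundAnn ⊆ Γ.Bin U ∪ Γ.J U 1 ∪ Γ.Bout U := by
  rintro _ ⟨z, hz, rfl⟩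
  rcases lt_trichotomy ‖z‖ 1 with h | h | h
  · exact Or.inl (Or.inl ⟨z, ⟨hz, h⟩, rfl⟩)
  · exact Or.inl (Or.inr ⟨z, mem_sphere_zero_iff_norm.2 h, rfl⟩)
  · exact Or.inr ⟨z, ⟨hz, h⟩, rfl⟩

/-- **The two half-collars lie on opposite sides of the unit curve**: one inside its inner domain,
the other outside. [folklore] -/
theorem Bin_Bout_sides :
    (Γ.Bin U ⊆ (Λ.dom Γ.y).carrier ∧ Γ.Bout U ⊆ (closure (Λ.dom Γ.y).carrier)ᶜ) ∨
    (Γ.Bin U ⊆ (closure (Λ.dom Γ.y).carrier)ᶜ ∧ Γ.Bout U ⊆ (Λ.dom Γ.y).carrier) := by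
  set D := Λ.dom Γ.y with hD
  have hfr : frontier D.carrier = Γ.J U 1 := by rw [Λ.frontier_dom, J_one]
  have hin := D.subset_or_subset_of_disjoint_frontier (Γ.isConnected_Bin U).isPreconnected (hfr ▸ Γ.disjoint_Bin_J U)
  have hout := D.subset_or_subset_of_disjoint_frontier (Γ.isConnected_Bout U).isPreconnected (hfr ▸ Γ.disjoint_Bout_J U)
  -- the planar collar is an open neighbourhood of each point of the curve = frontier of `D`
  have hnbhd : ∀ S : Set ℂ, IsOpen S → (∃ q, q ∈ frontier D.carrier) →
      (∀ p ∈ frontier D.carrier, Γ.cP U '' roundAnn ∈ 𝓝 p) := fun _ _ _ p hp => by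
    refine (Γ.isOpen_image_cP_roundAnn U).mem_nhds ?_
    rw [hfr] at hp
    obtain ⟨z, hz, rfl⟩ := hp
    exact ⟨z, sphere_subset_roundAnn isRadius_one hz, rfl⟩
  obtain ⟨p, hp⟩ : ∃ p, p ∈ frontier D.carrier := by
    rw [hfr]; exact ⟨Γ.cP U 1, ⟨1, by simp, rfl⟩⟩
  have hN : Γ.cP U '' roundAnn ∈ 𝓝 p := hnbhd univ isOpen_univ ⟨p, hp⟩ p hp
  rcases hin with hin | hin <;> rcases hout with hout | hout
  · -- both inside: the neighbourhood misses the outer domain, yet `p ∈ closure` of it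
    exfalso
    obtain ⟨-, hfrE, -⟩ := D.exterior_of_JCT JordanCurveTheorem_holds
    have hpE : p ∈ closure (closure D.carrier)ᶜ := by
      have : p ∈ frontier (closure D.carrier)ᶜ := by rw [hfrE]; exact hp
      exact frontier_subset_closure this
    obtain ⟨q, hqN, hqE⟩ := mem_closure_iff_nhds.1 hpE _ hN
    rcases Γ.image_cP_roundAnn_subset U hqN with (h | h) | h
    · exact hqE (subset_closure (hin h))
    · rw [← hfr] at h; exact hqE (frontier_subset_closure h)
    · exact hqE (subset_closure (hout h))
  · exact Or.inl ⟨hin, hout⟩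
  · exact Or.inr ⟨hin, hout⟩
  · -- both outside: the neighbourhood misses `D`, yet `p ∈ closure D`
    exfalso
    obtain ⟨q, hqN, hqD⟩ := mem_closure_iff_nhds.1 (frontier_subset_closure hp) _ hN
    rcases Γ.image_cP_roundAnn_subset U hqN with (h | h) | h
    · exact hin h (subset_closure hqD)
    · rw [← hfr, frontier_eq_closure_inter_closure, D.isOpen.isClosed_compl.closure_eq] at h
      exact h.2 hqD
    · exact hout h (subset_closure hqD)

/-! ### Reversing the collar swaps the two sides -/

/-- The radial inversion `z ↦ z / ‖z‖²` (i.e. `1 / conj z`). [folklore] -/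
def radInv (z : ℂ) : ℂ := ((‖z‖ ^ 2)⁻¹ : ℝ) • z

/-- Norm of the radial inversion. [folklore] -/
theorem norm_radInv {z : ℂ} (hz : z ≠ 0) : ‖radInv z‖ = ‖z‖⁻¹ := by
  have hn : 0 < ‖z‖ := norm_pos_iff.2 hz
  rw [radInv, norm_smul, Real.norm_eq_abs, abs_of_pos (by positivity)]
  field_simp

/-- The radial inversion maps the round annulus to itself. [folklore] -/
theorem radInv_mem_roundAnn {z : ℂ} (hz : z ∈ roundAnn) : radInv z ∈ roundAnn := by
  have hz0 := ne_zero_of_mem_roundAnn hz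
  have hn : 0 < ‖z‖ := norm_pos_iff.2 hz0
  refine ⟨?_, ?_⟩ <;> rw [norm_radInv hz0]
  · rw [show Real.exp (-(1 / 2)) = (Real.exp (1 / 2))⁻¹ by rw [Real.exp_neg]]
    exact inv_strictAnti₀ hn hz.2
  · have := inv_strictAnti₀ (Real.exp_pos _) hz.1
    rwa [← Real.exp_neg, neg_neg] at this

/-- **The reversed collar map is the collar map composed with the radial inversion.** [folklore] -/
theorem reverse_collarMap {z : ℂ} (hz : z ≠ 0) : Γ.reverse.collarMap U z = Γ.collarMap U (radInv z) := by
  have hn : 0 < ‖z‖ := norm_pos_iff.2 hz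
  rw [Collar.collarMap_eq, Collar.collarMap_eq, reverse_γ, reverse_σ, norm_radInv hz, Real.log_inv, radInv,
    Complex.real_smul, Complex.arg_real_mul z (by positivity)]
  ring_nf

/-- The inner half-collar of the reversed collar is the outer half-collar. [folklore] -/
theorem Bin_reverse : Γ.reverse.Bin U = Γ.Bout U := by
  ext w
  constructor
  · rintro ⟨z, ⟨hz, hz1⟩, rfl⟩
    have hz0 := ne_zero_of_mem_roundAnn hz
    refine ⟨radInv z, ⟨radInv_mem_roundAnn hz, ?_⟩, ?_⟩
    · rw [mem_Ioi, norm_radInv hz0]; exact one_lt_inv₀ (norm_pos_iff.2 hz0) |>.2 hz1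
    · show Γ.cP U (radInv z) = Γ.reverse.cP U z
      rw [cP, cP, Γ.reverse_collarMap U hz0]
  · rintro ⟨z, ⟨hz, hz1⟩, rfl⟩
    have hz0 := ne_zero_of_mem_roundAnn hz
    have hrr : radInv (radInv z) = z := by
      rw [radInv, norm_radInv hz0, radInv, smul_smul]
      have hn : ‖z‖ ≠ 0 := norm_ne_zero_iff.2 hz0
      rw [show ((‖z‖⁻¹ ^ 2)⁻¹ * (‖z‖ ^ 2)⁻¹ : ℝ) = 1 by field_simp, one_smul]
    refine ⟨radInv z, ⟨radInv_mem_roundAnn hz, ?_⟩, ?_⟩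
    · rw [mem_Iio, norm_radInv hz0]; exact inv_lt_one_of_one_lt₀ hz1
    · show Γ.reverse.cP U (radInv z) = Γ.cP U z
      rw [cP, cP, Γ.reverse_collarMap U (ne_zero_of_mem_roundAnn (radInv_mem_roundAnn hz)), hrr]

end Collar

/-- **A well-oriented collar of every level component**: collar data `Γ` based at `y` whose inner
half-collar lies in the inner domain of the component (reverse the collar if necessary).
[folklore] -/
theorem exists_collar_Bin_subset (Λ : LevelData 𝒮) (U : BandUnitField 1 Λ.f Λ.a) (y : Λ.Lv) :
    ∃ Γ : Λ.Collar, Γ.y = y ∧ Γ.Bin U ⊆ (Λ.dom y).carrier := by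
  obtain ⟨Γ, hΓy, -⟩ := Λ.nonempty_collar y
  subst hΓy
  rcases Γ.Bin_Bout_sides U with ⟨h, -⟩ | ⟨-, h⟩
  · exact ⟨Γ, rfl, h⟩
  · exact ⟨Γ.reverse, rfl, by rw [Collar.Bin_reverse]; exact h⟩

end LevelData

end PlaneAtlas

end Literature.Topology.FourManifolds

end


noncomputable section

namespace Literature.Topology.FourManifolds

open _root_.Set _root_.Metric _root_.OpenPartialHomeomorph _root_.Filter
open scoped _root_.Manifold _root_.Topology _root_.ContDiff
open Literature.Geometry.Manifold (AtlasOn)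
open Literature.Geometry.Manifold.AtlasOn
open Literature.Probability.RandomPlanarGeometry (JordanDomain)
open Literature.Probability.RandomPlanarGeometry.JordanDomain
open Literature.Topology.PlaneTopology

/-- Local notation for the model plane `ℝ²`. -/
local notation "𝔼₂" => EuclideanSpace ℝ (Fin 2)

namespace PlaneAtlas

namespace LevelData

namespace Collar

variable {ρ η : ℝ} {𝒮 : PlaneAtlas (annulus ρ η)} {Λ : LevelData 𝒮} (Γ : Λ.Collar) (U : BandUnitField 1 Λ.f Λ.a)

/-! ### Nesting of the curves of a well-oriented collar -/

section Nest

variable (hBin : Γ.Bin U ⊆ (Λ.dom Γ.y).carrier)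

/-- An inner curve lies in the inner half-collar. [folklore] -/
theorem J_subset_Bin {r₀ : ℝ} (hr₀ : IsRadius r₀) (hr₀1 : r₀ < 1) : Γ.J U r₀ ⊆ Γ.Bin U := by
  rintro _ ⟨z, hz, rfl⟩
  exact ⟨z, ⟨sphere_subset_roundAnn hr₀ hz, by rw [mem_sphere_zero_iff_norm] at hz; rw [mem_Iio, hz]; exact hr₀1⟩, rfl⟩

include hBin in
/-- **An inner curve lies in the inner domain of the unit curve.** [folklore] -/
theorem J_subset_dom {r₀ : ℝ} (hr₀ : IsRadius r₀) (hr₀1 : r₀ < 1) : Γ.J U r₀ ⊆ (Λ.dom Γ.y).carrier :=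
  (Γ.J_subset_Bin U hr₀ hr₀1).trans hBin

include hBin in
/-- **The unit curve lies outside the closed inner disc of an inner curve.** [folklore] -/
theorem J_one_subset_compl_closure {r₀ : ℝ} (hr₀ : IsRadius r₀) (hr₀1 : r₀ < 1) :
    Γ.J U 1 ⊆ (closure (Γ.domR U hr₀).carrier)ᶜ := by
  set D := Λ.dom Γ.y with hD
  set D₀ := Γ.domR U hr₀ with hD₀
  have hfr₀ : frontier D₀.carrier = Γ.J U r₀ := Γ.frontier_domR U hr₀
  have hfr₁ : frontier D.carrier = Γ.J U 1 := by rw [Λ.frontier_dom, J_one]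
  have hJ₀D : Γ.J U r₀ ⊆ D.carrier := Γ.J_subset_dom U hBin hr₀ hr₀1
  have hdisj : Disjoint (Γ.J U 1) (frontier D₀.carrier) := by
    rw [hfr₀]
    refine Set.disjoint_left.2 ?_
    rintro _ ⟨z, hz, rfl⟩ ⟨z', hz', heq⟩
    have := Γ.injOn_cP U (sphere_subset_roundAnn hr₀ hz') (sphere_subset_roundAnn isRadius_one hz) heq
    rw [mem_sphere_zero_iff_norm] at hz hz'
    rw [this, hz] at hz'; linarith
  have hJ1conn : IsPreconnected (Γ.J U 1) :=
    ((isConnected_sphere (by rw [Complex.rank_real_complex]; norm_num) (0 : ℂ) zero_le_one).image _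
      ((Γ.continuousOn_cP U).mono (sphere_subset_roundAnn isRadius_one))).isPreconnected
  rcases D₀.subset_or_subset_of_disjoint_frontier hJ1conn hdisj with h | h
  · exfalso
    -- the outer domain of `D₀` is unbounded, connected and misses `J 1 = ∂D`, so it lies outside `D`;
    -- then `∂D₀ ⊆ closure (outside of D)` misses `D`, contradicting `J r₀ ⊆ D`
    obtain ⟨hEconn, hEfr, hEunb⟩ := D₀.exterior_of_JCT JordanCurveTheorem_holds
    have hEdisj : Disjoint (closure D₀.carrier)ᶜ (frontier D.carrier) := by
      rw [hfr₁]; exact Set.disjoint_left.2 fun z hz hz' => hz (subset_closure (h hz'))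
    rcases D.subset_or_subset_of_disjoint_frontier hEconn.isPreconnected hEdisj with h' | h'
    · exact hEunb (D.isBounded.subset h')
    · have h1 : frontier (closure D₀.carrier)ᶜ ⊆ closure (closure D.carrier)ᶜ :=
        frontier_subset_closure.trans (closure_mono h')
      rw [hEfr, hfr₀] at h1
      obtain ⟨p, hp⟩ : (Γ.J U r₀).Nonempty := ⟨Γ.cP U r₀, ⟨r₀, by simp [abs_of_pos hr₀.pos], rfl⟩⟩
      have hpD : p ∈ D.carrier := hJ₀D hp
      have hpc : p ∈ closure (closure D.carrier)ᶜ := h1 hp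
      obtain ⟨q, hqD, hqE⟩ := mem_closure_iff_nhds.1 hpc _ (D.isOpen.mem_nhds hpD)
      exact hqE (subset_closure hqD)
  · exact h

include hBin in
/-- **The inner disc of an inner curve lies in the inner domain of the unit curve.** [folklore] -/
theorem closure_domR_subset_dom {r₀ : ℝ} (hr₀ : IsRadius r₀) (hr₀1 : r₀ < 1) :
    closure (Γ.domR U hr₀).carrier ⊆ (Λ.dom Γ.y).carrier := by
  set D := Λ.dom Γ.y with hD
  set D₀ := Γ.domR U hr₀ with hD₀
  have hfr₁ : frontier D.carrier = Γ.J U 1 := by rw [Λ.frontier_dom, J_one]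
  have hJ1 := Γ.J_one_subset_compl_closure U hBin hr₀ hr₀1
  have hdisj : Disjoint D₀.carrier (frontier D.carrier) := by
    rw [hfr₁]; exact Set.disjoint_left.2 fun z hz hz' => hJ1 hz' (subset_closure hz)
  have hD₀D : D₀.carrier ⊆ D.carrier := by
    rcases D.subset_or_subset_of_disjoint_frontier D₀.isConnected.isPreconnected hdisj with h | h
    · exact h
    · exfalso
      obtain ⟨p, hp⟩ : (Γ.J U r₀).Nonempty := ⟨Γ.cP U r₀, ⟨r₀, by simp [abs_of_pos hr₀.pos], rfl⟩⟩
      have hpD : p ∈ D.carrier := Γ.J_subset_dom U hBin hr₀ hr₀1 hp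
      have hpc : p ∈ closure D₀.carrier := by
        rw [← Γ.frontier_domR U hr₀] at hp; exact frontier_subset_closure hp
      obtain ⟨q, hqD, hq₀⟩ := mem_closure_iff_nhds.1 hpc _ (D.isOpen.mem_nhds hpD)
      exact h hq₀ (subset_closure hqD)
  rw [closure_eq_self_union_frontier, Γ.frontier_domR U hr₀]
  exact union_subset hD₀D (Γ.J_subset_dom U hBin hr₀ hr₀1)

/-- The open collar band `cP {r₀ < ‖z‖ < 1}`. [folklore] -/
def band (r₀ : ℝ) : Set ℂ := Γ.cP U '' {z | z ∈ roundAnn ∧ ‖z‖ ∈ Ioo r₀ 1}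

/-- The open collar band is open. [folklore] -/
theorem isOpen_band (r₀ : ℝ) : IsOpen (Γ.band U r₀) := Γ.isOpen_image_cP U isOpen_Ioo

/-- The open collar band lies in the inner half-collar. [folklore] -/
theorem band_subset_Bin (r₀ : ℝ) : Γ.band U r₀ ⊆ Γ.Bin U := by
  rintro _ ⟨z, ⟨hz, hzI⟩, rfl⟩; exact ⟨z, ⟨hz, hzI.2⟩, rfl⟩

include hBin in
/-- **The open collar band lies outside the closed inner disc of the inner curve.** [folklore] -/
theorem band_subset_compl_closure {r₀ : ℝ} (hr₀ : IsRadius r₀) (hr₀1 : r₀ < 1) :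
    Γ.band U r₀ ⊆ (closure (Γ.domR U hr₀).carrier)ᶜ := by
  set D₀ := Γ.domR U hr₀ with hD₀
  have hconn : IsPreconnected (Γ.band U r₀) := by
    have h1 : {z : ℂ | z ∈ roundAnn ∧ ‖z‖ ∈ Ioo r₀ 1} = annulus ((1 + r₀) / 2) ((1 - r₀) / 2) := by
      ext z
      simp only [mem_setOf_eq, roundAnn, mem_Ioo, mem_annulus]
      constructor
      · rintro ⟨-, ha, hb⟩; constructor <;> linarith
      · rintro ⟨ha, hb⟩
        refine ⟨⟨by linarith [hr₀.1], ?_⟩, by linarith, by linarith⟩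
        linarith [isRadius_one.2]
    have h2 : IsConnected {z : ℂ | z ∈ roundAnn ∧ ‖z‖ ∈ Ioo r₀ 1} := by
      rw [h1]; exact isConnected_annulus (by linarith [hr₀.pos]) (by linarith)
    exact (h2.image _ ((Γ.continuousOn_cP U).mono fun _ hz => hz.1)).isPreconnected
  have hdisj : Disjoint (Γ.band U r₀) (frontier D₀.carrier) := by
    rw [hD₀, Γ.frontier_domR U hr₀]
    refine Set.disjoint_left.2 ?_
    rintro _ ⟨z, ⟨hz, hzI⟩, rfl⟩ ⟨z', hz', heq⟩
    have := Γ.injOn_cP U (sphere_subset_roundAnn hr₀ hz') hz heq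
    rw [mem_sphere_zero_iff_norm] at hz'
    rw [← this, hz'] at hzI; exact lt_irrefl _ hzI.1
  rcases D₀.subset_or_subset_of_disjoint_frontier hconn hdisj with h | h
  · exfalso
    -- the point `cP 1` of the unit curve is outside `closure D₀`, an open condition; nearby band points too
    have h1 : Γ.cP U 1 ∈ (closure D₀.carrier)ᶜ :=
      Γ.J_one_subset_compl_closure U hBin hr₀ hr₀1 ⟨1, by simp, rfl⟩
    have hcont : ContinuousWithinAt (Γ.cP U) roundAnn 1 :=
      Γ.continuousOn_cP U 1 (sphere_subset_roundAnn isRadius_one (by simp))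
    have hN := hcont (isClosed_closure.isOpen_compl.mem_nhds h1)
    rw [mem_map, mem_nhdsWithin] at hN
    obtain ⟨O, hO, h1O, hOsub⟩ := hN
    obtain ⟨ε, hε, hball⟩ := Metric.isOpen_iff.1 hO 1 h1O
    -- the real point `t = max r₀ (1 - ε/2)` … rather `t` slightly below `1`
    set t : ℝ := max ((1 + r₀) / 2) (1 - ε / 2) with ht
    have ht1 : t < 1 := max_lt (by linarith) (by linarith)
    have htr : r₀ < t := lt_of_lt_of_le (by linarith) (le_max_left _ _)
    have htpos : 0 < t := hr₀.pos.trans htr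
    have htA : (t : ℂ) ∈ roundAnn := by
      refine ⟨?_, ?_⟩ <;> rw [Complex.norm_real, Real.norm_eq_abs, abs_of_pos htpos]
      · exact hr₀.1.trans htr
      · exact ht1.trans isRadius_one.2
    have htO : (t : ℂ) ∈ O := hball (by
      rw [mem_ball, dist_eq_norm, ← Complex.ofReal_one, ← Complex.ofReal_sub, Complex.norm_real, Real.norm_eq_abs,
        abs_of_nonpos (by linarith)]
      linarith [le_max_right ((1 + r₀) / 2) (1 - ε / 2)])
    have hmem : Γ.cP U t ∈ Γ.band U r₀ :=
      ⟨t, ⟨htA, by rw [Complex.norm_real, Real.norm_eq_abs, abs_of_pos htpos]; exact ⟨htr, ht1⟩⟩, rfl⟩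
    exact hOsub ⟨htO, htA⟩ (subset_closure (h hmem))
  · exact h

include hBin in
/-- **The region between an inner curve and the unit curve is the open collar band**:
`dom ∖ closure (domR r₀) = cP {r₀ < ‖z‖ < 1}` (the region is connected by the annulus theorem,
and the band is clopen in it). [folklore] -/
theorem dom_diff_closure_domR_eq {r₀ : ℝ} (hr₀ : IsRadius r₀) (hr₀1 : r₀ < 1) :
    (Λ.dom Γ.y).carrier \ closure (Γ.domR U hr₀).carrier = Γ.band U r₀ := by
  set D := Λ.dom Γ.y with hD
  set D₀ := Γ.domR U hr₀ with hD₀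
  set R := D.carrier \ closure D₀.carrier with hR
  have hcl₀ : closure D₀.carrier ⊆ D.carrier := Γ.closure_domR_subset_dom U hBin hr₀ hr₀1
  -- the region is connected (annulus theorem)
  have hRconn : IsPreconnected R := by
    obtain ⟨H, hH1, hH2, -⟩ := exists_homeomorph_image_annulus hcl₀
    have hcb : H '' closedBall 0 1 = closure D₀.carrier := by
      rw [← closure_ball (0 : ℂ) one_ne_zero, H.image_closure, hH1]
    have : R = H '' (ball 0 2 \ closedBall 0 1) := by
      rw [image_sdiff H.injective, hH2, hcb]
    rw [this]
    refine (IsConnected.image ?_ _ H.continuous.continuousOn).isPreconnected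
    have : ball (0 : ℂ) 2 \ closedBall 0 1 = annulus (3 / 2) (1 / 2) := by
      ext z
      simp only [Set.mem_sdiff, mem_ball_zero_iff, mem_closedBall_zero_iff, not_le, mem_annulus]
      constructor
      · rintro ⟨h1, h2⟩; constructor <;> linarith
      · rintro ⟨h1, h2⟩; constructor <;> linarith
    rw [this]; exact isConnected_annulus (by norm_num) (by norm_num)
  -- the band is inside the region
  have hBR : Γ.band U r₀ ⊆ R := fun w hw =>
    ⟨hBin (Γ.band_subset_Bin U r₀ hw), Γ.band_subset_compl_closure U hBin hr₀ hr₀1 hw⟩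
  -- the closure of the band adds only points of the two curves, which are not in the region
  have hclB : closure (Γ.band U r₀) ∩ R ⊆ Γ.band U r₀ := by
    have hK : IsCompact {z : ℂ | r₀ ≤ ‖z‖ ∧ ‖z‖ ≤ 1} := by
      have : {z : ℂ | r₀ ≤ ‖z‖ ∧ ‖z‖ ≤ 1} = closedBall 0 1 ∩ {z | r₀ ≤ ‖z‖} := by
        ext z; simp only [mem_setOf_eq, mem_inter_iff, mem_closedBall_zero_iff]; tauto
      rw [this]
      exact (isCompact_closedBall 0 1).inter_right (isClosed_le continuous_const continuous_norm)
    have hKA : {z : ℂ | r₀ ≤ ‖z‖ ∧ ‖z‖ ≤ 1} ⊆ roundAnn := fun z hz =>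
      ⟨hr₀.1.trans_le hz.1, hz.2.trans_lt isRadius_one.2⟩
    have hcl : closure (Γ.band U r₀) ⊆ Γ.cP U '' {z : ℂ | r₀ ≤ ‖z‖ ∧ ‖z‖ ≤ 1} :=
      closure_minimal (image_mono fun z hz => ⟨hz.2.1.le, hz.2.2.le⟩)
        ((hK.image_of_continuousOn ((Γ.continuousOn_cP U).mono hKA)).isClosed)
    rintro w ⟨hw, hwR⟩
    obtain ⟨z, hz, rfl⟩ := hcl hw
    rcases hz.1.eq_or_lt with h0 | h0
    · -- on the inner curve: inside `closure D₀`
      exfalso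
      refine hwR.2 (frontier_subset_closure ?_)
      rw [Γ.frontier_domR U hr₀]
      exact ⟨z, mem_sphere_zero_iff_norm.2 h0.symm, rfl⟩
    rcases hz.2.eq_or_lt with h1 | h1
    · -- on the unit curve: not in the open `D`
      exfalso
      have : Γ.cP U z ∈ frontier D.carrier := by
        rw [Λ.frontier_dom, ← J_one]; exact ⟨z, mem_sphere_zero_iff_norm.2 h1, rfl⟩
      rw [frontier_eq_closure_inter_closure, D.isOpen.isClosed_compl.closure_eq] at this
      exact this.2 hwR.1
    · exact ⟨z, ⟨hKA hz, h0, h1⟩, rfl⟩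
  -- the band is clopen in the connected region and nonempty: it is the region
  refine Subset.antisymm ?_ hBR
  have hne : (Γ.band U r₀).Nonempty := by
    set t : ℝ := (1 + r₀) / 2 with ht
    have htpos : 0 < t := by have := hr₀.pos; rw [ht]; positivity
    have e1 := hr₀.1
    have e2 := isRadius_one.2
    refine ⟨Γ.cP U t, t, ⟨⟨?_, ?_⟩, ?_⟩, rfl⟩ <;>
      simp only [Complex.norm_real, Real.norm_eq_abs, abs_of_pos htpos, mem_Ioo]
    · rw [ht]; linarith
    · rw [ht]; linarith
    · rw [ht]; constructor <;> linarith
  have hcover : R ⊆ Γ.band U r₀ ∪ (closure (Γ.band U r₀))ᶜ := fun w hw => by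
    by_cases hwB : w ∈ closure (Γ.band U r₀)
    · exact Or.inl (hclB ⟨hwB, hw⟩)
    · exact Or.inr hwB
  rcases hRconn.subset_or_subset (Γ.isOpen_band U r₀) isClosed_closure.isOpen_compl
    (Set.disjoint_left.2 fun w hw hw' => hw' (subset_closure hw)) hcover with h | h
  · exact h
  · exfalso
    obtain ⟨w, hw⟩ := hne
    exact h (hBR hw) (subset_closure hw)

end Nest

end Collar

end LevelData

end PlaneAtlas

end Literature.Topology.FourManifolds

end


noncomputable section

namespace Literature.Topology.FourManifolds

open _root_.Set _root_.Metric _root_.OpenPartialHomeomorph _root_.Filter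
open scoped _root_.Manifold _root_.Topology _root_.ContDiff
open Literature.Geometry.Manifold (AtlasOn)
open Literature.Geometry.Manifold.AtlasOn
open Literature.Probability.RandomPlanarGeometry (JordanDomain)
open Literature.Probability.RandomPlanarGeometry.JordanDomain
open Literature.Topology.PlaneTopology

/-- Local notation for the model plane `ℝ²`. -/
local notation "𝔼₂" => EuclideanSpace ℝ (Fin 2)

namespace PlaneAtlas

/-! ### Agreement of a transported standard structure with an atlas -/

/-- **The standard structure transported along a partial homeomorphism `s` agrees with an atlas
`𝒯` over `O ⊆ s.source`** as soon as, for every chart `e ∈ 𝒯`, the maps `e ∘ s⁻¹` and `s ∘ e⁻¹`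
are `C^∞` on the relevant images (`(stdAtlas s.target).pullback s` is the atlas with the single
chart `cι ∘ s`). [folklore] -/
theorem agreeOn_pullback_stdAtlas_of_contDiffOn {V O : Set ℂ} (𝒯 : PlaneAtlas V) (s : OpenPartialHomeomorph ℂ ℂ)
    (hO : IsOpen O) (hOs : O ⊆ s.source)
    (h1 : ∀ e ∈ 𝒯.charts, ContDiffOn ℝ ∞ (e ∘ s.symm) (s '' (O ∩ e.source)))
    (h2 : ∀ e ∈ 𝒯.charts, ContDiffOn ℝ ∞ (fun x => cι (s (e.symm x))) (e '' (O ∩ e.source))) :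
    ((stdAtlas s.target s.open_target).pullback s).AgreeOn 𝒯 O := by
  rintro _ ⟨c, hc, rfl⟩ e he
  rw [stdAtlas_charts, mem_singleton_iff] at hc
  subst hc
  set φ := s ≫ₕ stdChart.restr s.target with hφ
  -- the two transition maps, as functions
  have hF : ∀ y, (φ.symm ≫ₕ e.restr O) y = e (s.symm (cι.symm y)) := fun y => rfl
  have hF' : ∀ y, (e.symm ≫ₕ φ.restr O).symm y = e (s.symm (cι.symm y)) := fun y => rfl
  have hG : ∀ x, (e.symm ≫ₕ φ.restr O) x = cι (s (e.symm x)) := fun x => rfl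
  have hG' : ∀ x, (φ.symm ≫ₕ e.restr O).symm x = cι (s (e.symm x)) := fun x => rfl
  -- smoothness of `y ↦ e (s⁻¹ (cι⁻¹ y))` on `cι '' (s '' (O ∩ e.source))`
  have hA : ContDiffOn ℝ ∞ (fun y => e (s.symm (cι.symm y))) (cι.symm ⁻¹' (s '' (O ∩ e.source))) :=
    (h1 e he).comp cι.symm.contDiff.contDiffOn fun y hy => hy
  have hB : ContDiffOn ℝ ∞ (fun x => cι (s (e.symm x))) (e '' (O ∩ e.source)) := h2 e he
  -- membership of points of the sources
  have key1 : ∀ y, y ∈ (φ.symm ≫ₕ e.restr O).source → cι.symm y ∈ s '' (O ∩ e.source) := by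
    intro y hy
    simp only [trans_source, symm_source, mem_inter_iff, mem_preimage, restr_source' _ _ hO, hφ, trans_target,
      restr_target, stdChart_target, univ_inter, interior_eq_iff_isOpen.2 s.open_target, coe_trans_symm,
      Function.comp_apply, stdChart_restr_symm_apply] at hy
    obtain ⟨⟨hy1, -⟩, hy2, hy3⟩ := hy
    exact ⟨s.symm (cι.symm y), ⟨hy3, hy2⟩, s.right_inv hy1⟩
  have key2 : ∀ x, x ∈ (e.symm ≫ₕ φ.restr O).source → x ∈ e '' (O ∩ e.source) := by
    intro x hx
    simp only [trans_source, symm_source, mem_inter_iff, mem_preimage, restr_source' _ _ hO] at hx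
    obtain ⟨hx1, -, hx3⟩ := hx
    exact ⟨e.symm x, ⟨hx3, e.map_target hx1⟩, e.right_inv hx1⟩
  refine ⟨mem_contDiffGroupoid_euclidean_iff.2 ⟨?_, ?_⟩, mem_contDiffGroupoid_euclidean_iff.2 ⟨?_, ?_⟩⟩
  · exact (hA.mono fun y hy => key1 y hy).congr fun y _ => hF y
  · -- the target of `φ⁻¹ ≫ e|O` consists of points `x = e z`, `z ∈ O ∩ e.source`
    refine (hB.mono fun x hx => ?_).congr fun x _ => hG' x
    have hx' := (φ.symm ≫ₕ e.restr O).map_target hx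
    have heq : (φ.symm ≫ₕ e.restr O) ((φ.symm ≫ₕ e.restr O).symm x) = x := (φ.symm ≫ₕ e.restr O).right_inv hx
    obtain ⟨z, hz, hzy⟩ := key1 _ hx'
    refine ⟨z, hz, ?_⟩
    rw [← heq, hF, ← hzy, s.left_inv (hOs hz.1)]
  · exact (hB.mono fun x hx => key2 x hx).congr fun x _ => hG x
  · refine (hA.mono fun y hy => ?_).congr fun y _ => hF' y
    have hy' := (e.symm ≫ₕ φ.restr O).map_target hy
    have heq : (e.symm ≫ₕ φ.restr O) ((e.symm ≫ₕ φ.restr O).symm y) = y := (e.symm ≫ₕ φ.restr O).right_inv hy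
    obtain ⟨z, hz, hzx⟩ := key2 _ hy'
    refine ⟨z, hz, ?_⟩
    have : cι.symm y = s (e.symm ((e.symm ≫ₕ φ.restr O).symm y)) := by
      conv_lhs => rw [← heq, hG]
      rw [ContinuousLinearEquiv.symm_apply_apply]
    rw [this, ← hzx, e.left_inv hz.2]

namespace LevelData

namespace Collar

variable {ρ η : ℝ} {𝒮 : PlaneAtlas (annulus ρ η)} {Λ : LevelData 𝒮} (Γ : Λ.Collar) (U : BandUnitField 1 Λ.f Λ.a)

/-! ### The cap: a homeomorphism of the closed unit disc onto the closed inner domain, equal to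
the planar collar on the collar -/

section Cap

variable (hBin : Γ.Bin U ⊆ (Λ.dom Γ.y).carrier)

/-- The closed shell `{r₀ ≤ ‖z‖ ≤ 1}`. [folklore] -/
def shell (r₀ : ℝ) : Set ℂ := {z | r₀ ≤ ‖z‖ ∧ ‖z‖ ≤ 1}

/-- The shell is closed. [folklore] -/
theorem isClosed_shell (r₀ : ℝ) : IsClosed (shell r₀) :=
  (isClosed_le continuous_const continuous_norm).inter (isClosed_le continuous_norm continuous_const)

/-- The shell lies in the round annulus. [folklore] -/
theorem shell_subset_roundAnn {r₀ : ℝ} (hr₀ : IsRadius r₀) : shell r₀ ⊆ roundAnn := fun _ hz =>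
  ⟨hr₀.1.trans_le hz.1, hz.2.trans_lt isRadius_one.2⟩

/-- The closed unit disc is the small closed disc and the shell (`r₀ < 1`). [folklore] -/
theorem closedBall_eq_union {r₀ : ℝ} (hr₀1 : r₀ < 1) : closedBall (0 : ℂ) 1 = closedBall 0 r₀ ∪ shell r₀ := by
  ext z
  simp only [mem_closedBall_zero_iff, mem_union, shell, mem_setOf_eq]
  constructor
  · intro h; by_cases h' : ‖z‖ ≤ r₀
    · exact Or.inl h'
    · exact Or.inr ⟨(not_le.1 h').le, h⟩
  · rintro (h | h)
    · linarith
    · exact h.2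

/-- The small closed disc meets the shell in the circle of radius `r₀` (`r₀ < 1`). [folklore] -/
theorem closedBall_inter_shell {r₀ : ℝ} (hr₀1 : r₀ < 1) : closedBall (0 : ℂ) r₀ ∩ shell r₀ = sphere 0 r₀ := by
  ext z
  simp only [mem_inter_iff, mem_closedBall_zero_iff, shell, mem_setOf_eq, mem_sphere_zero_iff_norm]
  constructor
  · rintro ⟨h1, h2, -⟩; linarith
  · intro h; rw [h]; exact ⟨le_rfl, le_rfl, hr₀1.le⟩

include hBin in
/-- The planar collar image of the shell meets the closed inner disc of the inner curve only
along `J r₀`. [folklore] -/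
theorem image_cP_shell_inter_closure_subset {r₀ : ℝ} (hr₀ : IsRadius r₀) (hr₀1 : r₀ < 1) :
    closure (Γ.domR U hr₀).carrier ∩ Γ.cP U '' shell r₀ ⊆ Γ.cP U '' sphere 0 r₀ := by
  rintro _ ⟨hw, z, hz, rfl⟩
  rcases hz.1.eq_or_lt with h0 | h0
  · exact ⟨z, mem_sphere_zero_iff_norm.2 h0.symm, rfl⟩
  rcases hz.2.eq_or_lt with h1 | h1
  · exact absurd hw (Γ.J_one_subset_compl_closure U hBin hr₀ hr₀1 ⟨z, mem_sphere_zero_iff_norm.2 h1, rfl⟩)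
  · exact absurd hw (Γ.band_subset_compl_closure U hBin hr₀ hr₀1 ⟨z, ⟨shell_subset_roundAnn hr₀ hz, h0, h1⟩, rfl⟩)

/-- **Cap data**: a Schoenflies filler of the inner curve of radius `r₀`. [folklore] -/
structure CapFill {r₀ : ℝ} (hr₀ : IsRadius r₀) where
  /-- The filling homeomorphism. -/
  h₀ : ℂ ≃ₜ ℂ
  /-- It agrees with the planar collar on the circle of radius `r₀`. -/
  eqOn : EqOn h₀ (Γ.cP U) (sphere 0 r₀)
  /-- It maps the small disc onto the inner domain of the inner curve. -/
  image_ball : h₀ '' ball 0 r₀ = (Γ.domR U hr₀).carrier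
  /-- It maps the small circle onto the inner curve. -/
  image_sphere : h₀ '' sphere 0 r₀ = Γ.J U r₀

/-- Cap data exist (Schoenflies theorem with prescribed boundary values). [folklore] -/
theorem nonempty_capFill {r₀ : ℝ} (hr₀ : IsRadius r₀) : Nonempty (Γ.CapFill U hr₀) := by
  have hfr : frontier (disc r₀ hr₀.pos).carrier = sphere (0 : ℂ) r₀ := frontier_disc_carrier
  have hbij : BijOn (Γ.cP U) (frontier (disc r₀ hr₀.pos).carrier) (frontier (Γ.domR U hr₀).carrier) := by
    rw [hfr, Γ.frontier_domR U hr₀]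
    exact ((Γ.injOn_cP U).mono (sphere_subset_roundAnn hr₀)).bijOn_image
  obtain ⟨h, hh, hball, hsph, -⟩ := (disc r₀ hr₀.pos).exists_homeomorph_eqOn_frontier (Γ.domR U hr₀)
    (by rw [hfr]; exact (Γ.continuousOn_cP U).mono (sphere_subset_roundAnn hr₀)) hbij
  rw [hfr] at hh hsph
  rw [carrier_disc] at hball
  rw [Γ.frontier_domR U hr₀] at hsph
  exact ⟨⟨h, hh, hball, hsph⟩⟩

variable {Γ U} {r₀ : ℝ} {hr₀ : IsRadius r₀} (F : Γ.CapFill U hr₀)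

/-- **The cap map**: the filler on the small closed disc, the planar collar outside. [folklore] -/
def cap (z : ℂ) : ℂ := if ‖z‖ ≤ r₀ then F.h₀ z else Γ.cP U z

/-- The cap map is the piecewise map. [folklore] -/
theorem cap_eq [∀ j, Decidable (j ∈ closedBall (0 : ℂ) r₀)] : cap F = (closedBall (0 : ℂ) r₀).piecewise F.h₀ (Γ.cP U) := by
  funext z
  by_cases h : ‖z‖ ≤ r₀
  · rw [piecewise_eq_of_mem _ _ _ (mem_closedBall_zero_iff.2 h), cap, if_pos h]
  · rw [piecewise_eq_of_notMem _ _ _ (fun h' => h (mem_closedBall_zero_iff.1 h')), cap, if_neg h]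

/-- On the small closed disc the cap is the filler. [folklore] -/
theorem cap_of_le {z : ℂ} (hz : ‖z‖ ≤ r₀) : cap F z = F.h₀ z := by
  rw [cap, if_pos hz]

/-- Off the small closed disc the cap is the planar collar. [folklore] -/
theorem cap_of_lt {z : ℂ} (hz : r₀ < ‖z‖) : cap F z = Γ.cP U z := by
  rw [cap, if_neg (not_le.2 hz)]

/-- On the shell the cap is the planar collar. [folklore] -/
theorem cap_of_mem_shell {z : ℂ} (hz : z ∈ shell r₀) : cap F z = Γ.cP U z := by
  rcases hz.1.eq_or_lt with h | h
  · rw [cap_of_le F (le_of_eq h.symm)]; exact F.eqOn (mem_sphere_zero_iff_norm.2 h.symm)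
  · exact cap_of_lt F h

/-- The filler maps the small closed disc onto the closed inner domain of the inner curve.
[folklore] -/
theorem image_h₀_closedBall : F.h₀ '' closedBall 0 r₀ = closure (Γ.domR U hr₀).carrier := by
  rw [← ball_union_sphere, image_union, F.image_ball, F.image_sphere, closure_eq_self_union_frontier, Γ.frontier_domR U hr₀]

/-- The cap is continuous on the closed unit disc. [folklore] -/
theorem continuousOn_cap (hr₀1 : r₀ < 1) : ContinuousOn (cap F) (closedBall 0 1) := by
  classical
  rw [closedBall_eq_union hr₀1, cap_eq]
  refine continuousOn_piecewise_of_isClosed isClosed_closedBall (isClosed_shell r₀) F.h₀.continuous.continuousOn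
    ((Γ.continuousOn_cP U).mono (shell_subset_roundAnn hr₀)) ?_
  rw [closedBall_inter_shell hr₀1]; exact F.eqOn

include hBin in
/-- **The cap is a bijection of the closed unit disc onto the closed inner domain of the unit
curve.** [folklore] -/
theorem bijOn_cap (hr₀1 : r₀ < 1) : BijOn (cap F) (closedBall 0 1) (closure (Λ.dom Γ.y).carrier) := by
  classical
  rw [cap_eq]
  have key := bijOn_piecewise (f := F.h₀) (g := Γ.cP U) (A := closedBall (0 : ℂ) r₀) (A' := shell r₀)
    (B := closure (Γ.domR U hr₀).carrier) (B' := Γ.cP U '' shell r₀)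
    (by rw [← image_h₀_closedBall F]; exact F.h₀.injective.injOn.bijOn_image)
    (((Γ.injOn_cP U).mono (shell_subset_roundAnn hr₀)).bijOn_image)
    (by rw [closedBall_inter_shell hr₀1]; exact F.eqOn)
    (by rw [closedBall_inter_shell hr₀1, F.image_sphere]; exact Γ.image_cP_shell_inter_closure_subset U hBin hr₀ hr₀1)
  rw [← closedBall_eq_union hr₀1] at key
  convert key using 1
  -- `closure dom = closure (domR r₀) ∪ cP '' shell`
  have hreg := Γ.dom_diff_closure_domR_eq U hBin hr₀ hr₀1
  have hcl₀ := Γ.closure_domR_subset_dom U hBin hr₀ hr₀1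
  have hshell : Γ.cP U '' shell r₀ = Γ.J U r₀ ∪ Γ.band U r₀ ∪ Γ.J U 1 := by
    apply Subset.antisymm
    · rintro _ ⟨z, hz, rfl⟩
      rcases hz.1.eq_or_lt with h0 | h0
      · exact Or.inl (Or.inl ⟨z, mem_sphere_zero_iff_norm.2 h0.symm, rfl⟩)
      rcases hz.2.eq_or_lt with h1 | h1
      · exact Or.inr ⟨z, mem_sphere_zero_iff_norm.2 h1, rfl⟩
      · exact Or.inl (Or.inr ⟨z, ⟨shell_subset_roundAnn hr₀ hz, h0, h1⟩, rfl⟩)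
    · rintro w ((⟨z, hz, rfl⟩ | ⟨z, ⟨-, hz⟩, rfl⟩) | ⟨z, hz, rfl⟩)
      · exact ⟨z, ⟨(mem_sphere_zero_iff_norm.1 hz).ge, by rw [mem_sphere_zero_iff_norm.1 hz]; exact hr₀1.le⟩, rfl⟩
      · exact ⟨z, ⟨hz.1.le, hz.2.le⟩, rfl⟩
      · exact ⟨z, ⟨by rw [mem_sphere_zero_iff_norm.1 hz]; exact hr₀1.le, (mem_sphere_zero_iff_norm.1 hz).le⟩, rfl⟩
  rw [hshell, closure_eq_self_union_frontier, Λ.frontier_dom, ← J_one]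
  have hdom : (Λ.dom Γ.y).carrier = closure (Γ.domR U hr₀).carrier ∪ Γ.band U r₀ := by
    rw [← hreg, union_sdiff_cancel hcl₀]
  have hJ₀ : Γ.J U r₀ ⊆ closure (Γ.domR U hr₀).carrier := by
    rw [← Γ.frontier_domR U hr₀]; exact frontier_subset_closure
  rw [hdom]
  ext w; simp only [mem_union]; constructor
  · rintro ((h | h) | h)
    · exact Or.inl h
    · exact Or.inr (Or.inl (Or.inr h))
    · exact Or.inr (Or.inr h)
  · rintro (h | ((h | h) | h))
    · exact Or.inl (Or.inl h)
    · exact Or.inl (Or.inl (hJ₀ h))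
    · exact Or.inl (Or.inr h)
    · exact Or.inr h

include hBin in
/-- The cap maps the open unit disc onto the inner domain of the unit curve. [folklore] -/
theorem image_cap_ball (hr₀1 : r₀ < 1) : cap F '' ball 0 1 = (Λ.dom Γ.y).carrier := by
  have hreg := Γ.dom_diff_closure_domR_eq U hBin hr₀ hr₀1
  have hcl₀ := Γ.closure_domR_subset_dom U hBin hr₀ hr₀1
  have h1 : cap F '' closedBall 0 r₀ = closure (Γ.domR U hr₀).carrier := by
    rw [← image_h₀_closedBall F]; exact image_congr fun z hz => cap_of_le F (mem_closedBall_zero_iff.1 hz)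
  have h2 : cap F '' {z | z ∈ roundAnn ∧ ‖z‖ ∈ Ioo r₀ 1} = Γ.band U r₀ :=
    image_congr fun z hz => cap_of_lt F hz.2.1
  have hball : ball (0 : ℂ) 1 = closedBall 0 r₀ ∪ {z | z ∈ roundAnn ∧ ‖z‖ ∈ Ioo r₀ 1} := by
    ext z
    simp only [mem_ball_zero_iff, mem_union, mem_closedBall_zero_iff, mem_setOf_eq, mem_Ioo]
    constructor
    · intro h
      by_cases h' : ‖z‖ ≤ r₀
      · exact Or.inl h'
      · exact Or.inr ⟨⟨hr₀.1.trans (not_le.1 h'), h.trans isRadius_one.2⟩, not_le.1 h', h⟩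
    · rintro (h | h)
      · linarith
      · exact h.2.2
  rw [hball, image_union, h1, h2, ← hreg, union_sdiff_cancel hcl₀]

include hBin in
/-- The cap maps the closed unit disc onto the closed inner domain. [folklore] -/
theorem image_cap_closedBall (hr₀1 : r₀ < 1) : cap F '' closedBall 0 1 = closure (Λ.dom Γ.y).carrier :=
  (bijOn_cap hBin F hr₀1).image_eq

include hBin in
/-- The cap is injective on the closed unit disc. [folklore] -/
theorem injOn_cap (hr₀1 : r₀ < 1) : InjOn (cap F) (closedBall 0 1) := (bijOn_cap hBin F hr₀1).injOn

include hBin in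
/-- **The cap chart**: the cap as an open partial homeomorphism from the open unit disc onto the
inner domain of the unit curve (inverse continuous as the inverse of a continuous injection on
the compact closed disc). [folklore] -/
def capChart (hr₀1 : r₀ < 1) : OpenPartialHomeomorph ℂ ℂ where
  toFun := cap F
  invFun := Function.invFunOn (cap F) (closedBall 0 1)
  source := ball 0 1
  target := (Λ.dom Γ.y).carrier
  map_source' z hz := by rw [← image_cap_ball hBin F hr₀1]; exact mem_image_of_mem _ hz
  map_target' w hw := by
    have hw' : w ∈ cap F '' closedBall 0 1 := by
      rw [image_cap_closedBall hBin F hr₀1]; exact subset_closure hw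
    have hmem : Function.invFunOn (cap F) (closedBall 0 1) w ∈ closedBall (0 : ℂ) 1 := Function.invFunOn_mem hw'
    have heq : cap F (Function.invFunOn (cap F) (closedBall 0 1) w) = w := Function.invFunOn_eq hw'
    -- not on the unit circle, whose image is the frontier
    rcases (mem_closedBall_zero_iff.1 hmem).eq_or_lt with h | h
    · exfalso
      have : w ∈ frontier (Λ.dom Γ.y).carrier := by
        rw [Λ.frontier_dom, ← J_one, ← heq, cap_of_mem_shell F ⟨by rw [h]; exact hr₀1.le, h.le⟩]
        exact ⟨_, mem_sphere_zero_iff_norm.2 h, rfl⟩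
      rw [frontier_eq_closure_inter_closure, (Λ.dom Γ.y).isOpen.isClosed_compl.closure_eq] at this
      exact this.2 hw
    · exact mem_ball_zero_iff.2 h
  left_inv' z hz := (injOn_cap hBin F hr₀1).leftInvOn_invFunOn (ball_subset_closedBall hz)
  right_inv' w hw := Function.invFunOn_eq (show w ∈ cap F '' closedBall 0 1 by
    rw [image_cap_closedBall hBin F hr₀1]; exact subset_closure hw)
  open_source := isOpen_ball
  open_target := (Λ.dom Γ.y).isOpen
  continuousOn_toFun := (continuousOn_cap F hr₀1).mono ball_subset_closedBall
  continuousOn_invFun := by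
    refine (Schoenflies.continuousOn_invFunOn (isCompact_closedBall 0 1) (continuousOn_cap F hr₀1)
      (injOn_cap hBin F hr₀1)).mono ?_
    rw [image_cap_closedBall hBin F hr₀1]; exact subset_closure

end Cap

end Collar

end LevelData

end PlaneAtlas

end Literature.Topology.FourManifolds

end


noncomputable section

namespace Literature.Topology.FourManifolds

open _root_.Set _root_.Metric _root_.OpenPartialHomeomorph _root_.Filter
open scoped _root_.Manifold _root_.Topology _root_.ContDiff
open Literature.Geometry.Manifold (AtlasOn)
open Literature.Geometry.Manifold.AtlasOn
open Literature.Probability.RandomPlanarGeometry (JordanDomain)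
open Literature.Probability.RandomPlanarGeometry.JordanDomain
open Literature.Topology.PlaneTopology

/-- Local notation for the model plane `ℝ²`. -/
local notation "𝔼₂" => EuclideanSpace ℝ (Fin 2)

/-- The outer region `{ρ + η ≤ ‖z‖}` lies outside the closed inner domain of a Jordan curve
contained in the annulus `{ρ - η < ‖z‖ < ρ + η}` (`0 ≤ ρ + η`). [folklore] -/
theorem _root_.Literature.Probability.RandomPlanarGeometry.JordanDomain.setOf_le_norm_subset_compl_closure
    (D : JordanDomain) {ρ η : ℝ} (hρη : 0 ≤ ρ + η) (hJ : frontier D.carrier ⊆ PlaneAtlas.annulus ρ η) :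
    {z : ℂ | ρ + η ≤ ‖z‖} ⊆ (closure D.carrier)ᶜ := by
  rcases D.subset_or_subset_of_disjoint_frontier (isConnected_setOf_le_norm hρη).isPreconnected
    (Set.disjoint_left.2 fun z hz hz' => by have := (hJ hz').2; simp only [mem_setOf_eq] at hz; linarith) with h | h
  · exfalso
    obtain ⟨R, hR⟩ := D.isBounded.subset_ball 0
    have hpos : 0 ≤ max R (ρ + η) + 1 := by linarith [le_max_right R (ρ + η)]
    have hmem : ((max R (ρ + η) + 1 : ℝ) : ℂ) ∈ {z : ℂ | ρ + η ≤ ‖z‖} := by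
      simp only [mem_setOf_eq, Complex.norm_real, Real.norm_eq_abs]
      rw [abs_of_nonneg hpos]
      linarith [le_max_right R (ρ + η)]
    have := hR (h hmem)
    rw [mem_ball_zero_iff, Complex.norm_real, Real.norm_eq_abs, abs_of_nonneg hpos] at this
    linarith [le_max_left R (ρ + η)]
  · exact h

/-- The inner domain of a Jordan curve contained in the annulus lies in the disc `{‖z‖ < ρ + η}`.
[folklore] -/
theorem _root_.Literature.Probability.RandomPlanarGeometry.JordanDomain.carrier_subset_ball_of_frontier_subset_annulus
    (D : JordanDomain) {ρ η : ℝ} (hρη : 0 ≤ ρ + η) (hJ : frontier D.carrier ⊆ PlaneAtlas.annulus ρ η) :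
    D.carrier ⊆ ball 0 (ρ + η) := fun z hz => by
  rw [mem_ball_zero_iff]
  by_contra hle
  push Not at hle
  exact D.setOf_le_norm_subset_compl_closure hρη hJ hle (subset_closure hz)

namespace PlaneAtlas

namespace LevelData

namespace Collar

variable {ρ η : ℝ} {𝒮 : PlaneAtlas (annulus ρ η)} {Λ : LevelData 𝒮} {Γ : Λ.Collar} {U : BandUnitField 1 Λ.f Λ.a}
  (hBin : Γ.Bin U ⊆ (Λ.dom Γ.y).carrier) {r₀ : ℝ} {hr₀ : IsRadius r₀} (F : Γ.CapFill U hr₀) (hr₀1 : r₀ < 1)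

/-! ### The inverse cap on the collar band -/

include hBin in
/-- **The inverse cap of a band point**: if `w = cP z` with `r₀ < ‖z‖ < 1` then
`(capChart)⁻¹ w = z`. [folklore] -/
theorem capChart_symm_apply_cP {z : ℂ} (hzI : ‖z‖ ∈ Ioo r₀ 1) :
    (capChart hBin F hr₀1).symm (Γ.cP U z) = z := by
  have h1 : cap F z = Γ.cP U z := cap_of_lt F hzI.1
  rw [← h1]
  exact (capChart hBin F hr₀1).left_inv (mem_ball_zero_iff.2 hzI.2)

include hBin in
/-- Points of the band and their inverse caps. [folklore] -/
theorem exists_of_mem_band {w : ℂ} (hw : w ∈ Γ.band U r₀) :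
    ∃ z, z ∈ roundAnn ∧ ‖z‖ ∈ Ioo r₀ 1 ∧ Γ.cP U z = w ∧ (capChart hBin F hr₀1).symm w = z := by
  obtain ⟨z, ⟨hz, hzI⟩, rfl⟩ := hw
  exact ⟨z, hz, hzI, rfl, capChart_symm_apply_cP hBin F hr₀1 hzI⟩

/-! ### Agreement of the capped standard structure with the atlas over the band -/

include hBin in
/-- **Over the collar band, the standard structure transported by the cap agrees with every plane
atlas `𝒮₀` on `W ⊇ annulus` whose restriction to the annulus is `𝒮`** (the cap is the planar
collar there, which is `𝒮`-smooth with `𝒮`-smooth inverse). [folklore] -/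
theorem agreeOn_cap_band {W : Set ℂ} (𝒮₀ : PlaneAtlas W)
    (h𝒮 : 𝒮.charts = (fun e => e.restr (annulus ρ η)) '' 𝒮₀.charts) :
    ((stdAtlas (capChart hBin F hr₀1).symm.target (capChart hBin F hr₀1).symm.open_target).pullback
      (capChart hBin F hr₀1).symm).AgreeOn
      (𝒮₀.restrict (closure (Γ.domR U hr₀).carrier)ᶜ isClosed_closure.isOpen_compl) (Γ.band U r₀) := by
  set s := (capChart hBin F hr₀1).symm with hs
  have hA : IsOpen (annulus ρ η) := isOpen_annulus ρ η
  have hne : Nonempty 𝒮.opens := by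
    obtain ⟨w, hw⟩ := (Γ.isConnected_Bin U).nonempty
    obtain ⟨z, -, rfl⟩ := hw
    exact ⟨⟨_, Γ.cP_mem_annulus U z⟩⟩
  have hreg := Γ.dom_diff_closure_domR_eq U hBin hr₀ hr₀1
  refine agreeOn_pullback_stdAtlas_of_contDiffOn _ s (Γ.isOpen_band U r₀) (by rw [← hreg]; exact fun w hw => hw.1) ?_ ?_
  · -- `e ∘ cap` on `s '' (band ∩ e.source)`: this is `e ∘ cP` on a subset of the round annulus
    rintro _ ⟨e, he, rfl⟩
    have he' : e.restr (annulus ρ η) ∈ 𝒮.charts := by rw [h𝒮]; exact ⟨e, he, rfl⟩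
    have key := Γ.contDiffOn_chart_collarMap U he'
    refine (key.mono ?_).congr ?_
    · rintro _ ⟨w, ⟨hwB, hwe⟩, rfl⟩
      obtain ⟨z, hz, hzI, hzw, hsz⟩ := exists_of_mem_band hBin F hr₀1 hwB
      rw [hsz]
      refine ⟨hz, ?_⟩
      show 𝒮.val (Γ.collarMap U z) ∈ (e.restr (annulus ρ η)).source
      rw [restr_source' _ _ hA]
      rw [restr_source' _ _ isClosed_closure.isOpen_compl] at hwe
      exact ⟨by rw [← cP, hzw]; exact hwe.1, 𝒮.val_mem _⟩
    · rintro _ ⟨w, ⟨hwB, -⟩, rfl⟩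
      obtain ⟨z, -, hzI, -, hsz⟩ := exists_of_mem_band hBin F hr₀1 hwB
      rw [hsz]
      show e (cap F z) = e (Γ.cP U z)
      rw [cap_of_lt F hzI.1]
  · -- `cι ∘ s ∘ e⁻¹` on `e '' (band ∩ e.source)`: this is `cι ∘ collarInv ∘ (chart e)⁻¹`
    rintro _ ⟨e, he, rfl⟩
    have he' : e.restr (annulus ρ η) ∈ 𝒮.charts := by rw [h𝒮]; exact ⟨e, he, rfl⟩
    have key := Γ.contDiffOn_collarInv_chart_symm U he' hne
    refine (cι.contDiff.comp_contDiffOn (key.mono ?_)).congr ?_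
    · rintro _ ⟨w, ⟨hwB, hwe⟩, rfl⟩
      obtain ⟨z, hz, hzI, hzw, hsz⟩ := exists_of_mem_band hBin F hr₀1 hwB
      rw [restr_source' _ _ isClosed_closure.isOpen_compl] at hwe
      have hq : 𝒮.val (Γ.collarMap U z) = w := hzw
      refine ⟨Γ.collarMap U z, ⟨Γ.collarMap_mem_tubeC U hz, ?_⟩, ?_⟩
      · rw [chart_source]
        show 𝒮.val (Γ.collarMap U z) ∈ (e.restr (annulus ρ η)).source
        rw [restr_source' _ _ hA, hq]
        exact ⟨hwe.1, hq ▸ 𝒮.val_mem _⟩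
      · show (e.restr (annulus ρ η)) (𝒮.val (Γ.collarMap U z)) = (e.restr (closure (Γ.domR U hr₀).carrier)ᶜ) w
        simp only [restr_apply, hq]
    · rintro _ ⟨w, ⟨hwB, hwe⟩, rfl⟩
      obtain ⟨z, hz, hzI, hzw, hsz⟩ := exists_of_mem_band hBin F hr₀1 hwB
      rw [restr_source' _ _ isClosed_closure.isOpen_compl] at hwe
      have hwA : w ∈ annulus ρ η := by rw [← hzw]; exact Γ.cP_mem_annulus U z
      show cι (s ((e.restr (closure (Γ.domR U hr₀).carrier)ᶜ).symm (e w))) =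
        cι (Γ.collarInv U ((𝒮.chart (e.restr (annulus ρ η)) hne).symm ((e.restr (annulus ρ η)) w)))
      congr 1
      have h1 : (e.restr (closure (Γ.domR U hr₀).carrier)ᶜ).symm (e w) = w := e.left_inv hwe.1
      rw [h1, hsz]
      -- the point of `𝒮.Man` over `w` is `collarMap z`
      have htgt : (e.restr (annulus ρ η)) w ∈ (e.restr (annulus ρ η)).target := by
        apply OpenPartialHomeomorph.map_source
        rw [restr_source' _ _ hA]; exact ⟨hwe.1, hwA⟩
      have h2 : 𝒮.val ((𝒮.chart (e.restr (annulus ρ η)) hne).symm ((e.restr (annulus ρ η)) w)) = w := by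
        rw [val_chart_symm he' hne htgt]
        exact (e.restr (annulus ρ η)).left_inv (by rw [restr_source' _ _ hA]; exact ⟨hwe.1, hwA⟩)
      have h3 : (𝒮.chart (e.restr (annulus ρ η)) hne).symm ((e.restr (annulus ρ η)) w) = Γ.collarMap U z :=
        𝒮.val_injective (by rw [h2, ← hzw]; rfl)
      rw [h3, Γ.collarInv_collarMap U hz]

end Collar

end LevelData

/-! ### The essential seam: capping the exotic annulus -/

/-- The atlas restricted to the open annulus `{ρ - η < ‖z‖ < ρ + η} ⊆ W`: **the exotic annulus**
(as a plane atlas on the annulus). [folklore] -/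
def annulusAtlas {W : Set ℂ} (𝒮₀ : PlaneAtlas W) {ρ η : ℝ} (h : annulus ρ η ⊆ W) : PlaneAtlas (annulus ρ η) :=
  (𝒮₀.restrict (annulus ρ η) (isOpen_annulus ρ η)).copy (inter_eq_right.2 h)

/-- The charts of the exotic annulus are the restricted charts. [folklore] -/
theorem annulusAtlas_charts {W : Set ℂ} (𝒮₀ : PlaneAtlas W) {ρ η : ℝ} (h : annulus ρ η ⊆ W) :
    (annulusAtlas 𝒮₀ h).charts = (fun e => e.restr (annulus ρ η)) '' 𝒮₀.charts := rfl

/-- **Capping an exotic annulus.** Let `𝒮₀` be a plane atlas on `W ⊇ {ρ - η < ‖z‖ < ρ + η}`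
(`0 ≤ ρ - η`, `0 < η`). Then there is a plane atlas `𝒮'` on an open set `W'` with
`W ⊆ W' ⊆ W ∪ {‖z‖ < ρ + η}` and `{‖z‖ < ρ} ⊆ W'`, agreeing with `𝒮₀` off `{‖z‖ ≤ ρ + η}`: an
essential level circle of a proper Morse function of the exotic annulus (`exists_essential`)
carries a well-oriented `𝒮₀`-smooth collar (`exists_collar_Bin_subset`, `collarMap`), the
closed inner domain of the circle is capped by a disc glued smoothly along the collar
(`capChart`, `agreeOn_cap_band`), and the capped standard disc is glued to `𝒮₀` restricted to
the outside of a smaller level-collar circle (`AtlasOn.union`). [folklore] -/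
theorem exists_planeAtlas_cap {W : Set ℂ} (𝒮₀ : PlaneAtlas W) {ρ η : ℝ} (hρη : 0 ≤ ρ - η) (hη : 0 < η)
    (hW : annulus ρ η ⊆ W) :
    ∃ (W' : Set ℂ) (𝒮' : PlaneAtlas W'), W' ⊆ W ∪ ball 0 (ρ + η) ∧ W ⊆ W' ∧ ball 0 ρ ⊆ W' ∧
      𝒮'.AgreeOn 𝒮₀ (closedBall 0 (ρ + η))ᶜ := by
  set 𝒮 : PlaneAtlas (annulus ρ η) := annulusAtlas 𝒮₀ hW with h𝒮def
  have h𝒮 : 𝒮.charts = (fun e => e.restr (annulus ρ η)) '' 𝒮₀.charts := annulusAtlas_charts 𝒮₀ hW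
  obtain ⟨Λ⟩ := nonempty_levelData 𝒮 hρη hη
  obtain ⟨U⟩ := Λ.nonempty_bandUnitField
  obtain ⟨y, hy⟩ := Λ.exists_essential hρη hη
  obtain ⟨Γ, hΓy, hBin⟩ := Λ.exists_collar_Bin_subset U y
  subst hΓy
  -- the inner radius `r₀ = e^{-1/4}`
  set r₀ : ℝ := Real.exp (-(1 / 4)) with hr₀def
  have hr₀ : LevelData.Collar.IsRadius r₀ :=
    ⟨Real.exp_lt_exp.2 (by norm_num), Real.exp_lt_exp.2 (by norm_num)⟩
  have hr₀1 : r₀ < 1 := Real.exp_lt_one_iff.2 (by norm_num)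
  obtain ⟨F⟩ := Γ.nonempty_capFill U hr₀
  set s := (LevelData.Collar.capChart hBin F hr₀1).symm with hs
  set D := Λ.dom Γ.y with hD
  set D₀ := Γ.domR U hr₀ with hD₀
  have hreg : D.carrier \ closure D₀.carrier = Γ.band U r₀ := Γ.dom_diff_closure_domR_eq U hBin hr₀ hr₀1
  have hcl₀ : closure D₀.carrier ⊆ D.carrier := Γ.closure_domR_subset_dom U hBin hr₀ hr₀1
  -- the two pieces
  set 𝒜in := (stdAtlas s.target s.open_target).pullback s with h𝒜in
  have hOc : IsOpen (closure D₀.carrier)ᶜ := isClosed_closure.isOpen_compl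
  set 𝒜out := 𝒮₀.restrict (closure D₀.carrier)ᶜ hOc with h𝒜out
  have hagree : 𝒜in.AgreeOn 𝒜out (Γ.band U r₀) := LevelData.Collar.agreeOn_cap_band hBin F hr₀1 𝒮₀ h𝒮
  have hsrc : s.source = D.carrier := rfl
  have hin_sub : s.source ∩ s ⁻¹' s.target ⊆ D.carrier := fun w hw => hw.1
  have hUV : s.source ∩ s ⁻¹' s.target ∩ (W ∩ (closure D₀.carrier)ᶜ) ⊆ Γ.band U r₀ := by
    rintro w ⟨hw, -, hw'⟩; rw [← hreg]; exact ⟨hin_sub hw, hw'⟩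
  set 𝒮' := 𝒜in.union 𝒜out hagree (Γ.isOpen_band U r₀) hUV with h𝒮'
  -- geometry of the inner domain
  have hfrD : frontier D.carrier ⊆ annulus ρ η := by rw [hD, Λ.frontier_dom]; exact Λ.curve_subset_annulus _
  have hDball : D.carrier ⊆ ball 0 (ρ + η) := D.carrier_subset_ball_of_frontier_subset_annulus (by linarith) hfrD
  have hDin : ∀ w ∈ D.carrier, w ∈ s.source ∩ s ⁻¹' s.target := fun w hw => ⟨hw, s.map_source hw⟩
  have hcore : closedBall (0 : ℂ) (ρ - η) ⊆ D.carrier := by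
    rcases D.subset_or_subset_of_disjoint_frontier (convex_closedBall (0 : ℂ) (ρ - η)).isPreconnected
      (Set.disjoint_left.2 fun z hz hz' => by
        have := (hfrD hz').1; rw [mem_closedBall_zero_iff] at hz; linarith) with h | h
    · exact h
    · exact absurd (subset_closure hy) (h (mem_closedBall_self hρη))
  refine ⟨_, 𝒮', ?_, ?_, ?_, ?_⟩
  · rintro w (hw | hw)
    · exact Or.inr (hDball (hin_sub hw))
    · exact Or.inl hw.1
  · intro w hw
    by_cases h : w ∈ closure D₀.carrier
    · exact Or.inl (hDin w (hcl₀ h))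
    · exact Or.inr ⟨hw, h⟩
  · intro w hw
    rw [mem_ball_zero_iff] at hw
    by_cases h : ‖w‖ ≤ ρ - η
    · exact Or.inl (hDin w (hcore (mem_closedBall_zero_iff.2 h)))
    · have hwA : w ∈ annulus ρ η := ⟨not_le.1 h, by linarith⟩
      by_cases h' : w ∈ closure D₀.carrier
      · exact Or.inl (hDin w (hcl₀ h'))
      · exact Or.inr ⟨hW hwA, h'⟩
  · set O : Set ℂ := (closedBall (0 : ℂ) (ρ + η))ᶜ with hO
    have hOo : IsOpen O := isClosed_closedBall.isOpen_compl
    refine (agreeOn_union_iff.2 ⟨?_, ?_⟩).symm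
    · refine (agreeOn_of_source_inter_eq_empty fun e he => ?_).symm
      obtain ⟨c, -, rfl⟩ := he
      rw [trans_source]
      ext w
      simp only [mem_inter_iff, mem_preimage, mem_empty_iff_false, iff_false, not_and, hO, mem_compl_iff, not_not]
      intro hw
      exact ball_subset_closedBall (hDball (hin_sub ⟨hw.1, s.map_source hw.1⟩))
    · exact (restrict_agreeOn 𝒮₀ hOc hOo).symm

end PlaneAtlas

end Literature.Topology.FourManifolds

end


noncomputable section

namespace Literature.Topology.FourManifolds

open _root_.Set _root_.Metric _root_.OpenPartialHomeomorph _root_.Filter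
open scoped _root_.Manifold _root_.Topology _root_.ContDiff
open Literature.Geometry.Manifold (AtlasOn)
open Literature.Geometry.Manifold.AtlasOn
open Literature.Probability.RandomPlanarGeometry (JordanDomain)
open Literature.Probability.RandomPlanarGeometry.JordanDomain
open Literature.Topology.PlaneTopology

/-- Local notation for the model plane `ℝ²`. -/
local notation "𝔼₂" => EuclideanSpace ℝ (Fin 2)

/-! ### The seam lemma -/

/-- **The seam lemma of the surface-smoothing induction.** Let `𝒮` be a smooth plane atlas on
the open set `W ⊆ ℂ` and `L ⊆ W` with `L ∩ {‖z‖ = 2}` closed. Then there is a smooth plane atlas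
`𝒮'` on an open `W' ⊆ W ∪ {‖z‖ < 3}` containing `W ∖ {‖z‖ ≤ 3}`, the disc `{‖z‖ < 2}` and `L`,
which agrees with `𝒮` off `{‖z‖ ≤ 3}`: if the seam circle `{‖z‖ = 2}` lies in `W`, cap the
exotic annulus around it (`PlaneAtlas.exists_planeAtlas_cap`, with a closed annulus around the
circle inside `W`, `PlaneAtlas.exists_annulus_subset`); otherwise straighten and glue along the
free seam (`exists_planeAtlas_seam_of_not_subset`). [folklore] -/
theorem exists_planeAtlas_seam {W : Set ℂ} (𝒮 : PlaneAtlas W) {L : Set ℂ} (hLW : L ⊆ W)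
    (hC : IsClosed (L ∩ sphere (0 : ℂ) 2)) :
    ∃ (W' : Set ℂ) (𝒮' : PlaneAtlas W'), W' ⊆ W ∪ ball 0 3 ∧ W \ closedBall 0 3 ⊆ W' ∧ ball 0 2 ⊆ W' ∧ L ⊆ W' ∧
      𝒮'.AgreeOn 𝒮 (closedBall 0 3)ᶜ := by
  by_cases hA : sphere (0 : ℂ) 2 ⊆ W
  · obtain ⟨η, hη, -, hsub⟩ := PlaneAtlas.exists_annulus_subset 𝒮.isOpen two_pos hA
    set η' : ℝ := min η (1 / 2) with hη'
    have hη'p : 0 < η' := lt_min hη (by norm_num)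
    have hη'1 : η' ≤ 1 / 2 := min_le_right _ _
    have hann : PlaneAtlas.annulus 2 η' ⊆ W := fun z hz =>
      hsub ⟨by linarith [hz.1, min_le_left η (1 / 2)], by linarith [hz.2, min_le_left η (1 / 2)]⟩
    obtain ⟨W', 𝒮', h1, h2, h3, h4⟩ := PlaneAtlas.exists_planeAtlas_cap 𝒮 (ρ := 2) (η := η') (by linarith) hη'p hann
    have h33 : closedBall (0 : ℂ) (2 + η') ⊆ closedBall 0 3 := closedBall_subset_closedBall (by linarith)
    refine ⟨W', 𝒮', ?_, fun z hz => h2 hz.1, h3, hLW.trans h2, ?_⟩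
    · exact h1.trans (union_subset_union_right _ (ball_subset_ball (by linarith)))
    · exact h4.mono isClosed_closedBall.isOpen_compl isClosed_closedBall.isOpen_compl (compl_subset_compl.2 h33)
  · obtain ⟨W', 𝒮', h1, h2, h3, h4, h5⟩ := exists_planeAtlas_seam_of_not_subset 𝒮 hLW hC hA
    exact ⟨W', 𝒮', h1.trans (union_subset_union_right _ (ball_subset_ball (by norm_num))), h2, h3, h4, h5⟩

end Literature.Topology.FourManifolds

end
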